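import Literature.Topology.FourManifolds.CappellShanesonClassGroupFifteen
import Literature.Topology.FourManifolds.CappellShanesonIdealCertificates
import HarnessLib

/-!
# The class group of the trace `22` field (discriminant `142097`, prime) and Gompf's conjecture
# for the traces `22` and `-17` (Kim–Yamada 2023, Theorem B)

Serves the named fact
`Literature.Topology.FourManifolds.kimYamada2023_nonempty_diffeomorph_sphere_four_of_trace_mem_Icc`
(`CappellShaneson.lean`; M. H. Kim, S. Yamada, Kyungpook Math. J. 63 (2023) 373–411 =
arXiv:1707.03860, Cor. C), reduced in the tree to Gompf's topological leaves and Theorem B in matrix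
form (`GompfConjectureForTrace n`) for the traces not yet proved. This file PROVES Theorem B for the
trace `22` (class group cyclic of order dividing `6`): `C(ℤ[Θ₂₂])` is covered by the six representatives
`(1, 1, 22)`, `(8, 3, 22)`, `(8, 9, 22)`, `(8, 27, 22)`, `(4, 5, 22)`, `(6, 11, 22)`, which move by Gompf
moves to the traces `22`, `10`, `4`, `-5`, `7`, `0` (Lemma 6.1 / §6.1), where Gompf's conjecture holds
— and, by Theorem A, for `-17 = 5 - 22`.

## The number theory

For a cubic number field `K` generated by a root `θ` of `f₂₂ = x³ - 22x² + 21x - 1`: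

* `Δ(f₂₂) = 142097` is prime, so `𝓞 K = ℤ[θ]`, `d_K = 142097`, `⌊M_K⌋ ≤ 106`;
* Dedekind–Kummer at `p ≤ 106` (Marcus, Ch. 3, Thm. 27): `2, 7, 23, 43, 47, 53, 59, 79, 83, 89, 103`
  are inert; `f₂₂ = (x - 8)(x² - 14x - 91) - 729` (so `𝔭₃ = (3, θ - 8)`, `𝔮₉ = (3, θ² - 14θ - 91)`, and
  `𝔭₃ᵏ = (3ᵏ, θ - 8)`), `f₂₂ ≡ (x - 4)(x² + 2x + 4) (mod 5)`; `41` and `97` split (`(x-4)(x-6)(x-12)`,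
  `(x-15)(x-39)(x-65)`); unique roots `6, 2, 14, 7, 12, 7, 28, 45, 43, 66, 64, 37` modulo
  `11, 13, 17, 19, 29, 31, 37, 61, 67, 71, 73, 101`;
* `g = [𝔭₃]` satisfies `g⁶ = 1`: `𝔭₃ (3ᵏ, θ - 8) = (3ᵏ⁺¹, θ - 8)` for `k = 1, …, 4` and
  `𝔭₃ (243, θ - 8) = (θ - 8)` (norm `729`); every other small prime is a power of `g` by an explicit
  relation with certified cofactors: `𝔭₃ 𝔮₉ = (3)`, `(9, θ - 8) 𝔭₅ = (θ + 1)`, `𝔭₅ 𝔮₂₅ = (5)`,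
  `𝔭₃ 𝔭₁₁ = (2θ - 1)`, `𝔭₃ 𝔭₁₃ = (θ - 2)`, `(27, θ - 8) 𝔭₁₇ = (4θ - 5)`, `𝔭₅ 𝔭₁₉ = (3θ - 2)`,
  `𝔭₁₇ 𝔭₂₉ = (5θ - 2)`, `(9, θ - 8) 𝔭₃₁ = (5θ - 4)`, `𝔭₅ 𝔭₃₇ = (4θ - 1)`, `𝔭₅ (41, θ - 4) = (θ - 4)`,
  `𝔭₁₁ (41, θ - 6) = (θ - 6)`, `𝔭₁₇ (41, θ - 12) = (2θ² - 1)`, `𝔭₅ 𝔭₆₁ = (θ² - 3θ + 1)`,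
  `𝔭₁₇ 𝔭₆₇ = (2θ² - 5θ + 1)`, `𝔭₁₁ 𝔭₇₁ = (θ + 5)`, `𝔭₁₉ 𝔭₇₃ = (θ² + θ + 1)`, `𝔭₁₃ (97, θ - 15) = (θ - 15)`,
  `𝔭₃ (97, θ - 39) = (5θ - 1)`, `(97, θ - 65) = (3θ - 1)`, `(9, θ - 8) 𝔭₁₀₁ = (14θ - 13)`;
* hence every ideal class is one of `g⁰, …, g⁵` (`classGroup_mem_six_twentytwo`).

Transport to `ℤ[X]/(f₂₂)` and Prop. 2.14 (`exists_isConj_standardCSMatrix_of_cover`):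
`isConj_standardCSMatrix_of_trace_eq_twentytwo`, `gompfConjectureForTrace_twentytwo`,
`gompfConjectureForTrace_neg_seventeen`. No named fact is introduced (D-0026).

## References

* [KimYamada2023] M. H. Kim, S. Yamada, Kyungpook Math. J. 63 (2023) 373–411 (arXiv:1707.03860):
  §2.3 (Prop. 2.14), §5 (Table 2), §6.1 (Lemma 6.1 and the proof of Thm. B), Thm. A.
* [Marcus2018] D. A. Marcus, *Number Fields*, 2nd ed., Ch. 3, Thm. 27 (Dedekind–Kummer); Ch. 5,
  Cor. 2 of Thm. 37 (Minkowski bound).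
-/

noncomputable section

open Set Polynomial Module NumberField Ideal
open scoped NumberField MatrixGroups nonZeroDivisors
open Literature.LinearAlgebra.Matrix

namespace Literature.Topology.FourManifolds


section Field

variable {K : Type*} [Field K] [NumberField K] {θ : K}

/-! ### Discriminant `142097` and `𝓞 K = ℤ[θ]` -/

/-- `Δ(f₂₂) = 22·20·19·17 - 23 = 142097`. [cite: KimYamada2023, §3 (Δ(fₙ) = n(n-2)(n-3)(n-5) - 23)] -/
theorem csDisc_twentytwo : csDisc 22 = 142097 := by
  decide

set_option maxRecDepth 8192 in
/-- `142097 = 142097` is squarefree, so `Δ(f₂₂)` has no factorisation `r² e` with `|e| > 2`,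
`r ≠ ±1`, and `𝓞 K = ℤ[θ]`. [folklore] -/
theorem csDisc_twentytwo_sq : ∀ r e : ℤ, csDisc 22 = r ^ 2 * e → 2 < |e| → IsUnit r :=
  isUnit_of_eq_sq_mul (B := 376) (by decide) (by decide) (by decide)

/-- `d_K = 142097` for the trace `22` field. [folklore] -/
theorem discr_eq_twentytwo (hθ : aeval θ (csPoly 22) = 0) (h3 : finrank ℚ K = 3) :
    NumberField.discr K = 142097 := by
  rw [discr_eq_csDisc_of_sq hθ h3 csDisc_twentytwo_sq, csDisc_twentytwo]

/-- The cubic relation `θ³ - 22θ² + 21θ - 1 = 0` in `𝓞 K`. [folklore] -/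
theorem thetaInt_rel_twentytwo (hθ : aeval θ (csPoly 22) = 0) :
    (thetaInt hθ) ^ 3 - 22 * (thetaInt hθ) ^ 2 + 21 * thetaInt hθ - 1 = 0 := by
  have rel := thetaInt_rel hθ
  push_cast at rel
  linear_combination rel

/-! ### The primes of norm at most `106` (Dedekind–Kummer) -/

set_option maxRecDepth 16384 in
/-- The inert primes `2, 7, 23, 43, 47, 53, 59, 79, 83, 89, 103` (no root of `f₂₂`): every prime above them is `(p)`. [folklore] -/
theorem eq_span_of_inert_twentytwo (hθ : aeval θ (csPoly 22) = 0) (h3 : finrank ℚ K = 3) {p : ℕ}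
    (hp : p = 2 ∨ p = 7 ∨ p = 23 ∨ p = 43 ∨ p = 47 ∨ p = 53 ∨ p = 59 ∨ p = 79 ∨ p = 83 ∨ p = 89 ∨ p = 103)
    {P : Ideal (𝓞 K)} (hP : P ∈ primesOver (span {(p : ℤ)}) (𝓞 K)) : P = span {(p : 𝓞 K)} := by
  rcases hp with rfl | rfl | rfl | rfl | rfl | rfl | rfl | rfl | rfl | rfl | rfl
  · exact eq_span_of_no_root_of_sq hθ h3 csDisc_twentytwo_sq (by norm_num) hP (by decide)
  · exact eq_span_of_no_root_of_sq hθ h3 csDisc_twentytwo_sq (by norm_num) hP (by decide)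
  · exact eq_span_of_no_root_of_sq hθ h3 csDisc_twentytwo_sq (by norm_num) hP (by decide)
  · exact eq_span_of_no_root_of_sq hθ h3 csDisc_twentytwo_sq (by norm_num) hP (by decide)
  · exact eq_span_of_no_root_of_sq hθ h3 csDisc_twentytwo_sq (by norm_num) hP (by decide)
  · exact eq_span_of_no_root_of_sq hθ h3 csDisc_twentytwo_sq (by norm_num) hP (by decide)
  · exact eq_span_of_no_root_of_sq hθ h3 csDisc_twentytwo_sq (by norm_num) hP (by decide)
  · exact eq_span_of_no_root_of_sq hθ h3 csDisc_twentytwo_sq (by norm_num) hP (by decide)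
  · exact eq_span_of_no_root_of_sq hθ h3 csDisc_twentytwo_sq (by norm_num) hP (by decide)
  · exact eq_span_of_no_root_of_sq hθ h3 csDisc_twentytwo_sq (by norm_num) hP (by decide)
  · exact eq_span_of_no_root_of_sq hθ h3 csDisc_twentytwo_sq (by norm_num) hP (by decide)

set_option maxRecDepth 16384 in
/-- The degree-one primes at primes with a unique root of `f₂₂`: `(11, θ - 6)`, `(13, θ - 2)`, `(17, θ - 14)`, `(19, θ - 7)`, `(29, θ - 12)`, `(31, θ - 7)`, `(37, θ - 28)`, `(61, θ - 45)`, `(67, θ - 43)`, `(71, θ - 66)`, `(73, θ - 64)`, `(101, θ - 37)` are the only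
primes `P` above them with `p ^ {f_P} ≤ 106`. [folklore] -/
theorem eq_span_pair_of_unique_root_twentytwo (hθ : aeval θ (csPoly 22) = 0) (h3 : finrank ℚ K = 3)
    {p : ℕ} {c₀ : ℤ}
    (hp : (p = 11 ∧ c₀ = 6) ∨ (p = 13 ∧ c₀ = 2) ∨ (p = 17 ∧ c₀ = 14) ∨ (p = 19 ∧ c₀ = 7) ∨ (p = 29 ∧ c₀ = 12) ∨ (p = 31 ∧ c₀ = 7) ∨ (p = 37 ∧ c₀ = 28) ∨ (p = 61 ∧ c₀ = 45) ∨ (p = 67 ∧ c₀ = 43) ∨ (p = 71 ∧ c₀ = 66) ∨ (p = 73 ∧ c₀ = 64) ∨ (p = 101 ∧ c₀ = 37))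
    {P : Ideal (𝓞 K)} (hP : P ∈ primesOver (span {(p : ℤ)}) (𝓞 K)) (hle : p ^ P.inertiaDeg ℤ ≤ 106) :
    P = span {(p : 𝓞 K), thetaInt hθ - (c₀ : 𝓞 K)} := by
  rcases hp with ⟨rfl, rfl⟩ | ⟨rfl, rfl⟩ | ⟨rfl, rfl⟩ | ⟨rfl, rfl⟩ | ⟨rfl, rfl⟩ | ⟨rfl, rfl⟩ | ⟨rfl, rfl⟩ | ⟨rfl, rfl⟩ | ⟨rfl, rfl⟩ | ⟨rfl, rfl⟩ | ⟨rfl, rfl⟩ | ⟨rfl, rfl⟩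
  · exact eq_span_pair_of_unique_root_of_sq hθ h3 csDisc_twentytwo_sq (by norm_num) hP hle
      (by decide) (by norm_num)
  · exact eq_span_pair_of_unique_root_of_sq hθ h3 csDisc_twentytwo_sq (by norm_num) hP hle
      (by decide) (by norm_num)
  · exact eq_span_pair_of_unique_root_of_sq hθ h3 csDisc_twentytwo_sq (by norm_num) hP hle
      (by decide) (by norm_num)
  · exact eq_span_pair_of_unique_root_of_sq hθ h3 csDisc_twentytwo_sq (by norm_num) hP hle
      (by decide) (by norm_num)
  · exact eq_span_pair_of_unique_root_of_sq hθ h3 csDisc_twentytwo_sq (by norm_num) hP hle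
      (by decide) (by norm_num)
  · exact eq_span_pair_of_unique_root_of_sq hθ h3 csDisc_twentytwo_sq (by norm_num) hP hle
      (by decide) (by norm_num)
  · exact eq_span_pair_of_unique_root_of_sq hθ h3 csDisc_twentytwo_sq (by norm_num) hP hle
      (by decide) (by norm_num)
  · exact eq_span_pair_of_unique_root_of_sq hθ h3 csDisc_twentytwo_sq (by norm_num) hP hle
      (by decide) (by norm_num)
  · exact eq_span_pair_of_unique_root_of_sq hθ h3 csDisc_twentytwo_sq (by norm_num) hP hle
      (by decide) (by norm_num)
  · exact eq_span_pair_of_unique_root_of_sq hθ h3 csDisc_twentytwo_sq (by norm_num) hP hle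
      (by decide) (by norm_num)
  · exact eq_span_pair_of_unique_root_of_sq hθ h3 csDisc_twentytwo_sq (by norm_num) hP hle
      (by decide) (by norm_num)
  · exact eq_span_pair_of_unique_root_of_sq hθ h3 csDisc_twentytwo_sq (by norm_num) hP hle
      (by decide) (by norm_num)

/-- `f₂₂ = (x - 8)(x^2 - 14 * x - 91) + 3(-243)`: the factorisation modulo `3`. [folklore] -/
theorem csPoly_twentytwo_eq_three :
    csPoly 22 = (X - 8) * (X ^ 2 - 14 * X - 91) + 3 * (-243) := by
  simp only [csPoly, map_sub, map_one, map_ofNat]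
  ring

set_option linter.unusedSimpArgs false in
/-- The lift `X ^ 2 - 14 * X - 91` reduces modulo `3` to the same expression in `𝔽₃[x]`. [folklore] -/
theorem map_quad_twentytwo_three :
    (X ^ 2 - 14 * X - 91 : ℤ[X]).map (Int.castRingHom (ZMod 3)) = X ^ 2 - 14 * X - 91 := by
  simp only [Polynomial.map_add, Polynomial.map_sub, Polynomial.map_neg, Polynomial.map_mul, Polynomial.map_pow,
    map_X, Polynomial.map_ofNat, Polynomial.map_one]

set_option linter.unusedSimpArgs false in
/-- `f₂₂ mod 3 = (x - 8)·(X ^ 2 - 14 * X - 91)`. [folklore] -/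
theorem csPolyMod_twentytwo_three :
    csPolyMod 22 3 = (X - C ((8 : ℤ) : ZMod 3)) *
      (X ^ 2 - 14 * X - 91 : ℤ[X]).map (Int.castRingHom (ZMod 3)) := by
  rw [csPolyMod, csPoly_twentytwo_eq_three, Polynomial.map_add]
  have hp : Polynomial.map (Int.castRingHom (ZMod 3)) (3 * (-243) : ℤ[X]) = 0 := by
    rw [Polynomial.map_mul, show (3 : ℤ[X]) = C 3 from rfl, Polynomial.map_C]
    have : (Int.castRingHom (ZMod 3)) 3 = 0 := by decide
    rw [this, C_0, zero_mul]
  rw [hp, add_zero, map_quad_twentytwo_three]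
  simp only [Polynomial.map_mul, Polynomial.map_sub, Polynomial.map_add, Polynomial.map_neg, Polynomial.map_pow,
    map_X, Polynomial.map_ofNat, Polynomial.map_one, Int.cast_ofNat, map_ofNat]

/-- `X ^ 2 - 14 * X - 91` is monic over `𝔽₃`. [folklore] -/
theorem monic_quad_twentytwo_three :
    ((X ^ 2 - 14 * X - 91 : ℤ[X]).map (Int.castRingHom (ZMod 3))).Monic := by
  rw [map_quad_twentytwo_three]
  monicity!

/-- `X ^ 2 - 14 * X - 91` has no root modulo `3`. [folklore] -/
theorem quad_twentytwo_three_ne_zero : ∀ c : ZMod 3, c ^ 2 - 14 * c - 91 ≠ 0 := by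
  decide

/-- `X ^ 2 - 14 * X - 91` is irreducible over `𝔽₃`. [folklore] -/
theorem irreducible_quad_twentytwo_three :
    Irreducible ((X ^ 2 - 14 * X - 91 : ℤ[X]).map (Int.castRingHom (ZMod 3))) := by
  haveI := Fact.mk (show Nat.Prime 3 by norm_num)
  rw [map_quad_twentytwo_three]
  have hdeg : (X ^ 2 - 14 * X - 91 : (ZMod 3)[X]).natDegree = 2 := by compute_degree!
  refine irreducible_of_degree_le_three_of_not_isRoot (by rw [hdeg]; decide) fun c hc =>
    quad_twentytwo_three_ne_zero c ?_
  have h := hc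
  rw [IsRoot.def] at h
  simpa using h

set_option linter.unusedSimpArgs false in
/-- **The primes above `3`**: `(3, θ - 8)` (degree one) and `(3, θ ^ 2 - 14 * θ - 91)` (degree two). [folklore] -/
theorem eq_P3_or_eq_Q3_twentytwo (hθ : aeval θ (csPoly 22) = 0) (h3 : finrank ℚ K = 3)
    {P : Ideal (𝓞 K)} (hP : P ∈ primesOver (span {((3 : ℕ) : ℤ)}) (𝓞 K)) :
    P = span {(3 : 𝓞 K), thetaInt hθ - 8} ∨
      P = span {(3 : 𝓞 K), thetaInt hθ ^ 2 - 14 * thetaInt hθ - 91} := by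
  rcases eq_span_pair_of_linear_mul_quadratic_of_sq hθ h3 csDisc_twentytwo_sq (by norm_num)
    monic_quad_twentytwo_three irreducible_quad_twentytwo_three csPolyMod_twentytwo_three hP with h | h
  · left; simpa using h
  · right
    simp only [map_add, map_sub, map_neg, map_mul, map_pow, aeval_X, map_ofNat, map_one] at h
    simpa using h

/-- `f₂₂ = (x - 4)(x^2 + 2 * x + 4) + 5(-4 * x^2 + 5 * x + 3)`: the factorisation modulo `5`. [folklore] -/
theorem csPoly_twentytwo_eq_five :
    csPoly 22 = (X - 4) * (X ^ 2 + 2 * X + 4) + 5 * (-4 * X ^ 2 + 5 * X + 3) := by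
  simp only [csPoly, map_sub, map_one, map_ofNat]
  ring

set_option linter.unusedSimpArgs false in
/-- The lift `X ^ 2 + 2 * X + 4` reduces modulo `5` to the same expression in `𝔽₅[x]`. [folklore] -/
theorem map_quad_twentytwo_five :
    (X ^ 2 + 2 * X + 4 : ℤ[X]).map (Int.castRingHom (ZMod 5)) = X ^ 2 + 2 * X + 4 := by
  simp only [Polynomial.map_add, Polynomial.map_sub, Polynomial.map_neg, Polynomial.map_mul, Polynomial.map_pow,
    map_X, Polynomial.map_ofNat, Polynomial.map_one]

set_option linter.unusedSimpArgs false in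
/-- `f₂₂ mod 5 = (x - 4)·(X ^ 2 + 2 * X + 4)`. [folklore] -/
theorem csPolyMod_twentytwo_five :
    csPolyMod 22 5 = (X - C ((4 : ℤ) : ZMod 5)) *
      (X ^ 2 + 2 * X + 4 : ℤ[X]).map (Int.castRingHom (ZMod 5)) := by
  rw [csPolyMod, csPoly_twentytwo_eq_five, Polynomial.map_add]
  have hp : Polynomial.map (Int.castRingHom (ZMod 5)) (5 * (-4 * X ^ 2 + 5 * X + 3) : ℤ[X]) = 0 := by
    rw [Polynomial.map_mul, show (5 : ℤ[X]) = C 5 from rfl, Polynomial.map_C]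
    have : (Int.castRingHom (ZMod 5)) 5 = 0 := by decide
    rw [this, C_0, zero_mul]
  rw [hp, add_zero, map_quad_twentytwo_five]
  simp only [Polynomial.map_mul, Polynomial.map_sub, Polynomial.map_add, Polynomial.map_neg, Polynomial.map_pow,
    map_X, Polynomial.map_ofNat, Polynomial.map_one, Int.cast_ofNat, map_ofNat]

/-- `X ^ 2 + 2 * X + 4` is monic over `𝔽₅`. [folklore] -/
theorem monic_quad_twentytwo_five :
    ((X ^ 2 + 2 * X + 4 : ℤ[X]).map (Int.castRingHom (ZMod 5))).Monic := by
  rw [map_quad_twentytwo_five]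
  monicity!

/-- `X ^ 2 + 2 * X + 4` has no root modulo `5`. [folklore] -/
theorem quad_twentytwo_five_ne_zero : ∀ c : ZMod 5, c ^ 2 + 2 * c + 4 ≠ 0 := by
  decide

/-- `X ^ 2 + 2 * X + 4` is irreducible over `𝔽₅`. [folklore] -/
theorem irreducible_quad_twentytwo_five :
    Irreducible ((X ^ 2 + 2 * X + 4 : ℤ[X]).map (Int.castRingHom (ZMod 5))) := by
  haveI := Fact.mk (show Nat.Prime 5 by norm_num)
  rw [map_quad_twentytwo_five]
  have hdeg : (X ^ 2 + 2 * X + 4 : (ZMod 5)[X]).natDegree = 2 := by compute_degree!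
  refine irreducible_of_degree_le_three_of_not_isRoot (by rw [hdeg]; decide) fun c hc =>
    quad_twentytwo_five_ne_zero c ?_
  have h := hc
  rw [IsRoot.def] at h
  simpa using h

set_option linter.unusedSimpArgs false in
/-- **The primes above `5`**: `(5, θ - 4)` (degree one) and `(5, θ ^ 2 + 2 * θ + 4)` (degree two). [folklore] -/
theorem eq_P5_or_eq_Q5_twentytwo (hθ : aeval θ (csPoly 22) = 0) (h3 : finrank ℚ K = 3)
    {P : Ideal (𝓞 K)} (hP : P ∈ primesOver (span {((5 : ℕ) : ℤ)}) (𝓞 K)) :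
    P = span {(5 : 𝓞 K), thetaInt hθ - 4} ∨
      P = span {(5 : 𝓞 K), thetaInt hθ ^ 2 + 2 * thetaInt hθ + 4} := by
  rcases eq_span_pair_of_linear_mul_quadratic_of_sq hθ h3 csDisc_twentytwo_sq (by norm_num)
    monic_quad_twentytwo_five irreducible_quad_twentytwo_five csPolyMod_twentytwo_five hP with h | h
  · left; simpa using h
  · right
    simp only [map_add, map_sub, map_neg, map_mul, map_pow, aeval_X, map_ofNat, map_one] at h
    simpa using h

/-- `f₂₂ = (x - 4)(x - 6)(x - 12) + 41(-3 * x + 7)`: `f₂₂ ≡ (x - 4)(x - 6)(x - 12) (mod 41)`. [folklore] -/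
theorem csPoly_twentytwo_eq_fortyone :
    csPoly 22 = (X - 4) * (X - 6) * (X - 12) + 41 * (-3 * X + 7) := by
  simp only [csPoly, map_sub, map_one, map_ofNat]
  ring

/-- `f₂₂ mod 41 = (x - 4)(x - 6)(x - 12)`. [folklore] -/
theorem csPolyMod_twentytwo_fortyone :
    csPolyMod 22 41 = (X - C ((4 : ℤ) : ZMod 41)) * (X - C ((6 : ℤ) : ZMod 41)) *
      (X - C ((12 : ℤ) : ZMod 41)) := by
  rw [csPolyMod, csPoly_twentytwo_eq_fortyone, Polynomial.map_add]
  have hp : Polynomial.map (Int.castRingHom (ZMod 41)) (41 * (-3 * X + 7) : ℤ[X]) = 0 := by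
    rw [Polynomial.map_mul, show (41 : ℤ[X]) = C 41 from rfl, Polynomial.map_C]
    have : (Int.castRingHom (ZMod 41)) 41 = 0 := by decide
    rw [this, C_0, zero_mul]
  rw [hp, add_zero]
  simp only [Polynomial.map_mul, Polynomial.map_sub, map_X, Polynomial.map_ofNat, Int.cast_ofNat,
    map_ofNat]

/-- **The primes above `41`**: `(41, θ - 4)`, `(41, θ - 6)`, `(41, θ - 12)`. [folklore] -/
theorem eq_P41_twentytwo (hθ : aeval θ (csPoly 22) = 0) (h3 : finrank ℚ K = 3)
    {P : Ideal (𝓞 K)} (hP : P ∈ primesOver (span {((41 : ℕ) : ℤ)}) (𝓞 K)) :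
    P = span {(41 : 𝓞 K), thetaInt hθ - 4} ∨ P = span {(41 : 𝓞 K), thetaInt hθ - 6} ∨
      P = span {(41 : 𝓞 K), thetaInt hθ - 12} := by
  rcases eq_span_pair_of_split_of_sq hθ h3 csDisc_twentytwo_sq (by norm_num)
    csPolyMod_twentytwo_fortyone hP with h | h | h
  · left; simpa using h
  · right; left; simpa using h
  · right; right; simpa using h

/-- `f₂₂ = (x - 15)(x - 39)(x - 65) + 97(x^2 - 42 * x + 392)`: `f₂₂ ≡ (x - 15)(x - 39)(x - 65) (mod 97)`. [folklore] -/
theorem csPoly_twentytwo_eq_ninetyseven :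
    csPoly 22 = (X - 15) * (X - 39) * (X - 65) + 97 * (X ^ 2 - 42 * X + 392) := by
  simp only [csPoly, map_sub, map_one, map_ofNat]
  ring

/-- `f₂₂ mod 97 = (x - 15)(x - 39)(x - 65)`. [folklore] -/
theorem csPolyMod_twentytwo_ninetyseven :
    csPolyMod 22 97 = (X - C ((15 : ℤ) : ZMod 97)) * (X - C ((39 : ℤ) : ZMod 97)) *
      (X - C ((65 : ℤ) : ZMod 97)) := by
  rw [csPolyMod, csPoly_twentytwo_eq_ninetyseven, Polynomial.map_add]
  have hp : Polynomial.map (Int.castRingHom (ZMod 97)) (97 * (X ^ 2 - 42 * X + 392) : ℤ[X]) = 0 := by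
    rw [Polynomial.map_mul, show (97 : ℤ[X]) = C 97 from rfl, Polynomial.map_C]
    have : (Int.castRingHom (ZMod 97)) 97 = 0 := by decide
    rw [this, C_0, zero_mul]
  rw [hp, add_zero]
  simp only [Polynomial.map_mul, Polynomial.map_sub, map_X, Polynomial.map_ofNat, Int.cast_ofNat,
    map_ofNat]

/-- **The primes above `97`**: `(97, θ - 15)`, `(97, θ - 39)`, `(97, θ - 65)`. [folklore] -/
theorem eq_P97_twentytwo (hθ : aeval θ (csPoly 22) = 0) (h3 : finrank ℚ K = 3)
    {P : Ideal (𝓞 K)} (hP : P ∈ primesOver (span {((97 : ℕ) : ℤ)}) (𝓞 K)) :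
    P = span {(97 : 𝓞 K), thetaInt hθ - 15} ∨ P = span {(97 : 𝓞 K), thetaInt hθ - 39} ∨
      P = span {(97 : 𝓞 K), thetaInt hθ - 65} := by
  rcases eq_span_pair_of_split_of_sq hθ h3 csDisc_twentytwo_sq (by norm_num)
    csPolyMod_twentytwo_ninetyseven hP with h | h | h
  · left; simpa using h
  · right; left; simpa using h
  · right; right; simpa using h

/-! ### Relations among the small primes: explicit generators -/

/-- **`𝔭₃² = (9, θ - 8)`** (`f₂₂(8) = -3⁶`, so `θ ≡ 8` is a root of `f₂₂` modulo `3⁶` and `𝔭₃ᵏ = (3ᵏ, θ - 8)` for `k ≤ 6`). [folklore] -/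
theorem P3_mul_P3_twentytwo (hθ : aeval θ (csPoly 22) = 0) :
    span {(3 : 𝓞 K), thetaInt hθ - 8} * span {(3 : 𝓞 K), thetaInt hθ - 8} =
      span {(9 : 𝓞 K), thetaInt hθ - 8} := by
  have rel := thetaInt_rel_twentytwo hθ
  set t := thetaInt hθ with ht
  exact span_pair_mul_span_pair_eq_span_pair
    (α₁ := 1) (β₁ := 0)
    (α₂ := 0) (β₂ := 3)
    (α₃ := 0) (β₃ := 3)
    (α₄ := -13527 * t ^ 2) (β₄ := 10688 * t ^ 2 - 27888 * t + 1328)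
    (u₁ := 1) (u₂ := 0) (u₃ := 0) (u₄ := 0)
    (v₁ := 14802 * t ^ 2 + 105225 * t) (v₂ := -345 * t) (v₃ := 0) (v₄ := -22088 * t + 345)
    (by ring) (by ring) (by ring) (by linear_combination (-10688 : 𝓞 K) * rel)
    (by ring) (by linear_combination (22088 : 𝓞 K) * rel)

/-- **`𝔭₃ (9, θ - 8) = (27, θ - 8)`** (`= 𝔭₃³`). [folklore] -/
theorem P3_mul_I2_twentytwo (hθ : aeval θ (csPoly 22) = 0) :
    span {(3 : 𝓞 K), thetaInt hθ - 8} * span {(9 : 𝓞 K), thetaInt hθ - 8} =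
      span {(27 : 𝓞 K), thetaInt hθ - 8} := by
  have rel := thetaInt_rel_twentytwo hθ
  set t := thetaInt hθ with ht
  exact span_pair_mul_span_pair_eq_span_pair
    (α₁ := 1) (β₁ := 0)
    (α₂ := 0) (β₂ := 3)
    (α₃ := 0) (β₃ := 9)
    (α₄ := -4509 * t ^ 2) (β₄ := 10688 * t ^ 2 - 27888 * t + 1328)
    (u₁ := 1) (u₂ := 0) (u₃ := 0) (u₄ := 0)
    (v₁ := -1161 * t ^ 2) (v₂ := -5520 * t) (v₃ := 0) (v₄ := 345 * t ^ 2 - 2078 * t)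
    (by ring) (by ring) (by ring) (by linear_combination (-10688 : 𝓞 K) * rel)
    (by ring) (by linear_combination (-345 * t + 8) * rel)

/-- **`𝔭₃ (27, θ - 8) = (81, θ - 8)`** (`= 𝔭₃⁴`). [folklore] -/
theorem P3_mul_I3_twentytwo (hθ : aeval θ (csPoly 22) = 0) :
    span {(3 : 𝓞 K), thetaInt hθ - 8} * span {(27 : 𝓞 K), thetaInt hθ - 8} =
      span {(81 : 𝓞 K), thetaInt hθ - 8} := by
  have rel := thetaInt_rel_twentytwo hθ
  set t := thetaInt hθ with ht
  exact span_pair_mul_span_pair_eq_span_pair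
    (α₁ := 1) (β₁ := 0)
    (α₂ := 0) (β₂ := 3)
    (α₃ := 0) (β₃ := 27)
    (α₄ := -1503 * t ^ 2) (β₄ := 10688 * t ^ 2 - 27888 * t + 1328)
    (u₁ := 1) (u₂ := 0) (u₃ := 0) (u₄ := 0)
    (v₁ := -387 * t ^ 2) (v₂ := -5520 * t) (v₃ := 0) (v₄ := 345 * t ^ 2 - 2078 * t)
    (by ring) (by ring) (by ring) (by linear_combination (-10688 : 𝓞 K) * rel)
    (by ring) (by linear_combination (-345 * t + 8) * rel)

/-- **`𝔭₃ (81, θ - 8) = (243, θ - 8)`** (`= 𝔭₃⁵`). [folklore] -/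
theorem P3_mul_I4_twentytwo (hθ : aeval θ (csPoly 22) = 0) :
    span {(3 : 𝓞 K), thetaInt hθ - 8} * span {(81 : 𝓞 K), thetaInt hθ - 8} =
      span {(243 : 𝓞 K), thetaInt hθ - 8} := by
  have rel := thetaInt_rel_twentytwo hθ
  set t := thetaInt hθ with ht
  exact span_pair_mul_span_pair_eq_span_pair
    (α₁ := 1) (β₁ := 0)
    (α₂ := 0) (β₂ := 3)
    (α₃ := 5103 * t ^ 2) (β₃ := -108864 * t ^ 2 + 284067 * t - 13527)
    (α₄ := -501 * t ^ 2) (β₄ := 10688 * t ^ 2 - 27888 * t + 1328)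
    (u₁ := 1) (u₂ := 0) (u₃ := 0) (u₄ := 0)
    (v₁ := -129 * t ^ 2) (v₂ := -5520 * t) (v₃ := 0) (v₄ := 345 * t ^ 2 - 2078 * t)
    (by ring) (by ring) (by linear_combination (108864 : 𝓞 K) * rel) (by linear_combination (-10688 : 𝓞 K) * rel)
    (by ring) (by linear_combination (-345 * t + 8) * rel)

/-- **`𝔭₃ (243, θ - 8) = (θ - 8)`** (`N(θ - 8) = 729 = 3⁶`): `[𝔭₃]⁶ = 1`. [folklore] -/
theorem P3_mul_I5_twentytwo (hθ : aeval θ (csPoly 22) = 0) :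
    span {(3 : 𝓞 K), thetaInt hθ - 8} * span {(243 : 𝓞 K), thetaInt hθ - 8} =
      span {thetaInt hθ - 8} := by
  have rel := thetaInt_rel_twentytwo hθ
  set t := thetaInt hθ with ht
  exact span_pair_mul_span_pair_eq_span_singleton
    (δ₁ := t ^ 2 - 14 * t - 91) (δ₂ := 3)
    (δ₃ := 243) (δ₄ := t - 8)
    (u₁ := -43 * t ^ 2) (u₂ := -5520 * t) (u₃ := 0) (u₄ := 345 * t ^ 2 - 2078 * t)
    (by linear_combination (-1 : 𝓞 K) * rel) (by ring)
    (by ring) (by ring)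
    (by linear_combination (-345 * t + 8) * rel)

/-- **`𝔭₃ 𝔮₉ = (3)`**, `𝔮₉ = (3, θ² - 14θ - 91)` the prime of degree two above `3` (`f₂₂ = (x - 8)(x² - 14x - 91) - 729`). [folklore] -/
theorem P3_mul_Q3_twentytwo (hθ : aeval θ (csPoly 22) = 0) :
    span {(3 : 𝓞 K), thetaInt hθ - 8} * span {(3 : 𝓞 K), thetaInt hθ ^ 2 - 14 * thetaInt hθ - 91} =
      span {3} := by
  have rel := thetaInt_rel_twentytwo hθ
  set t := thetaInt hθ with ht
  exact span_pair_mul_span_pair_eq_span_singleton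
    (δ₁ := 3) (δ₂ := t ^ 2 - 14 * t - 91)
    (δ₃ := t - 8) (δ₄ := 243)
    (u₁ := -2520 * t ^ 2 + 35496 * t) (u₂ := 961 * t) (u₃ := -128 * t + 120) (u₄ := 0)
    (by ring) (by ring)
    (by ring) (by linear_combination (1 : 𝓞 K) * rel)
    (by linear_combination (-2883 : 𝓞 K) * rel)

/-- **`(9, θ - 8) 𝔭₅ = (θ + 1)`** (`N = 45`): `[𝔭₅] = [𝔭₃]⁻²`. [folklore] -/
theorem I2_mul_P5_twentytwo (hθ : aeval θ (csPoly 22) = 0) :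
    span {(9 : 𝓞 K), thetaInt hθ - 8} * span {(5 : 𝓞 K), thetaInt hθ - 4} =
      span {thetaInt hθ + 1} := by
  have rel := thetaInt_rel_twentytwo hθ
  set t := thetaInt hθ with ht
  exact span_pair_mul_span_pair_eq_span_singleton
    (δ₁ := t ^ 2 - 23 * t + 44) (δ₂ := -t ^ 2 + 23 * t - 35)
    (δ₃ := -t ^ 2 + 23 * t - 39) (δ₄ := t ^ 2 - 22 * t + 31)
    (u₁ := 1) (u₂ := -1) (u₃ := 2) (u₄ := 0)
    (by linear_combination (-1 : 𝓞 K) * rel) (by linear_combination (1 : 𝓞 K) * rel)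
    (by linear_combination (1 : 𝓞 K) * rel) (by linear_combination (-1 : 𝓞 K) * rel)
    (by ring)

/-- **`𝔭₅ 𝔮₂₅ = (5)`**, `𝔮₂₅ = (5, θ² + 2θ + 4)` (`f₂₂ ≡ (x - 4)(x² + 2x + 4) (mod 5)`). [folklore] -/
theorem P5_mul_Q5_twentytwo (hθ : aeval θ (csPoly 22) = 0) :
    span {(5 : 𝓞 K), thetaInt hθ - 4} * span {(5 : 𝓞 K), thetaInt hθ ^ 2 + 2 * thetaInt hθ + 4} =
      span {5} := by
  have rel := thetaInt_rel_twentytwo hθ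
  set t := thetaInt hθ with ht
  exact span_pair_mul_span_pair_eq_span_singleton
    (δ₁ := 5) (δ₂ := t ^ 2 + 2 * t + 4)
    (δ₃ := t - 4) (δ₄ := 4 * t ^ 2 - 5 * t - 3)
    (u₁ := -14) (u₂ := 4) (u₃ := -13) (u₄ := -1)
    (by ring) (by ring)
    (by ring) (by linear_combination (1 : 𝓞 K) * rel)
    (by linear_combination (1 : 𝓞 K) * rel)

/-- **`𝔭₃ 𝔭₁₁ = (2θ - 1)`** (`N = -33`). [folklore] -/
theorem P3_mul_P11_twentytwo (hθ : aeval θ (csPoly 22) = 0) :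
    span {(3 : 𝓞 K), thetaInt hθ - 8} * span {(11 : 𝓞 K), thetaInt hθ - 6} =
      span {2 * thetaInt hθ - 1} := by
  have rel := thetaInt_rel_twentytwo hθ
  set t := thetaInt hθ with ht
  exact span_pair_mul_span_pair_eq_span_singleton
    (δ₁ := -4 * t ^ 2 + 86 * t - 41) (δ₂ := 2 * t ^ 2 - 43 * t + 22)
    (δ₃ := 10 * t ^ 2 - 215 * t + 108) (δ₄ := -5 * t ^ 2 + 108 * t - 58)
    (u₁ := 1) (u₂ := -3) (u₃ := 1) (u₄ := 0)
    (by linear_combination (8 : 𝓞 K) * rel) (by linear_combination (-4 : 𝓞 K) * rel)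
    (by linear_combination (-20 : 𝓞 K) * rel) (by linear_combination (10 : 𝓞 K) * rel)
    (by ring)

/-- **`𝔭₃ 𝔭₁₃ = (θ - 2)`** (`N = 39`). [folklore] -/
theorem P3_mul_P13_twentytwo (hθ : aeval θ (csPoly 22) = 0) :
    span {(3 : 𝓞 K), thetaInt hθ - 8} * span {(13 : 𝓞 K), thetaInt hθ - 2} =
      span {thetaInt hθ - 2} := by
  have rel := thetaInt_rel_twentytwo hθ
  set t := thetaInt hθ with ht
  exact span_pair_mul_span_pair_eq_span_singleton
    (δ₁ := t ^ 2 - 20 * t - 19) (δ₂ := 3)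
    (δ₃ := -2 * t ^ 2 + 40 * t + 51) (δ₄ := t - 8)
    (u₁ := 2) (u₂ := -4) (u₃ := 1) (u₄ := 0)
    (by linear_combination (-1 : 𝓞 K) * rel) (by ring)
    (by linear_combination (2 : 𝓞 K) * rel) (by ring)
    (by ring)

/-- **`(27, θ - 8) 𝔭₁₇ = (4θ - 5)`** (`N = 459 = 27·17`): `[𝔭₁₇] = [𝔭₃]⁻³`. [folklore] -/
theorem I3_mul_P17_twentytwo (hθ : aeval θ (csPoly 22) = 0) :
    span {(27 : 𝓞 K), thetaInt hθ - 8} * span {(17 : 𝓞 K), thetaInt hθ - 14} =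
      span {4 * thetaInt hθ - 5} := by
  have rel := thetaInt_rel_twentytwo hθ
  set t := thetaInt hθ with ht
  exact span_pair_mul_span_pair_eq_span_singleton
    (δ₁ := 16 * t ^ 2 - 332 * t - 79) (δ₂ := -12 * t ^ 2 + 249 * t + 66)
    (δ₃ := -4 * t ^ 2 + 83 * t + 24) (δ₄ := 3 * t ^ 2 - 62 * t - 20)
    (u₁ := -1) (u₂ := -3) (u₃ := 5) (u₄ := 0)
    (by linear_combination (-64 : 𝓞 K) * rel) (by linear_combination (48 : 𝓞 K) * rel)
    (by linear_combination (16 : 𝓞 K) * rel) (by linear_combination (-12 : 𝓞 K) * rel)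
    (by ring)

/-- **`𝔭₅ 𝔭₁₉ = (3θ - 2)`** (`N = -95`). [folklore] -/
theorem P5_mul_P19_twentytwo (hθ : aeval θ (csPoly 22) = 0) :
    span {(5 : 𝓞 K), thetaInt hθ - 4} * span {(19 : 𝓞 K), thetaInt hθ - 7} =
      span {3 * thetaInt hθ - 2} := by
  have rel := thetaInt_rel_twentytwo hθ
  set t := thetaInt hθ with ht
  exact span_pair_mul_span_pair_eq_span_singleton
    (δ₁ := -9 * t ^ 2 + 192 * t - 61) (δ₂ := 3 * t ^ 2 - 64 * t + 22)
    (δ₃ := 6 * t ^ 2 - 128 * t + 47) (δ₄ := -2 * t ^ 2 + 43 * t - 17)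
    (u₁ := -1) (u₂ := -7) (u₃ := 2) (u₄ := 0)
    (by linear_combination (27 : 𝓞 K) * rel) (by linear_combination (-9 : 𝓞 K) * rel)
    (by linear_combination (-18 : 𝓞 K) * rel) (by linear_combination (6 : 𝓞 K) * rel)
    (by ring)

/-- **`𝔭₁₇ 𝔭₂₉ = (5θ - 2)`** (`N = -493`). [folklore] -/
theorem P17_mul_P29_twentytwo (hθ : aeval θ (csPoly 22) = 0) :
    span {(17 : 𝓞 K), thetaInt hθ - 14} * span {(29 : 𝓞 K), thetaInt hθ - 12} =
      span {5 * thetaInt hθ - 2} := by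
  have rel := thetaInt_rel_twentytwo hθ
  set t := thetaInt hθ with ht
  exact span_pair_mul_span_pair_eq_span_singleton
    (δ₁ := -25 * t ^ 2 + 540 * t - 309) (δ₂ := 10 * t ^ 2 - 216 * t + 127)
    (δ₃ := 20 * t ^ 2 - 432 * t + 253) (δ₄ := -8 * t ^ 2 + 173 * t - 104)
    (u₁ := 0) (u₂ := 2) (u₃ := -1) (u₄ := 0)
    (by linear_combination (125 : 𝓞 K) * rel) (by linear_combination (-50 : 𝓞 K) * rel)
    (by linear_combination (-100 : 𝓞 K) * rel) (by linear_combination (40 : 𝓞 K) * rel)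
    (by ring)

/-- **`(9, θ - 8) 𝔭₃₁ = (5θ - 4)`** (`N = -279 = -9·31`). [folklore] -/
theorem I2_mul_P31_twentytwo (hθ : aeval θ (csPoly 22) = 0) :
    span {(9 : 𝓞 K), thetaInt hθ - 8} * span {(31 : 𝓞 K), thetaInt hθ - 7} =
      span {5 * thetaInt hθ - 4} := by
  have rel := thetaInt_rel_twentytwo hθ
  set t := thetaInt hθ with ht
  exact span_pair_mul_span_pair_eq_span_singleton
    (δ₁ := -25 * t ^ 2 + 530 * t - 101) (δ₂ := 5 * t ^ 2 - 106 * t + 22)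
    (δ₃ := 20 * t ^ 2 - 424 * t + 87) (δ₄ := -4 * t ^ 2 + 85 * t - 19)
    (u₁ := 0) (u₂ := 4) (u₃ := -1) (u₄ := 0)
    (by linear_combination (125 : 𝓞 K) * rel) (by linear_combination (-25 : 𝓞 K) * rel)
    (by linear_combination (-100 : 𝓞 K) * rel) (by linear_combination (20 : 𝓞 K) * rel)
    (by ring)

/-- **`𝔭₅ 𝔭₃₇ = (4θ - 1)`** (`N = -185`). [folklore] -/
theorem P5_mul_P37_twentytwo (hθ : aeval θ (csPoly 22) = 0) :
    span {(5 : 𝓞 K), thetaInt hθ - 4} * span {(37 : 𝓞 K), thetaInt hθ - 28} =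
      span {4 * thetaInt hθ - 1} := by
  have rel := thetaInt_rel_twentytwo hθ
  set t := thetaInt hθ with ht
  exact span_pair_mul_span_pair_eq_span_singleton
    (δ₁ := -16 * t ^ 2 + 348 * t - 249) (δ₂ := 12 * t ^ 2 - 261 * t + 188)
    (δ₃ := 12 * t ^ 2 - 261 * t + 196) (δ₄ := -9 * t ^ 2 + 196 * t - 148)
    (u₁ := -9) (u₂ := -14) (u₃ := 2) (u₄ := 0)
    (by linear_combination (64 : 𝓞 K) * rel) (by linear_combination (-48 : 𝓞 K) * rel)
    (by linear_combination (-48 : 𝓞 K) * rel) (by linear_combination (36 : 𝓞 K) * rel)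
    (by ring)

/-- **`𝔭₅ (41, θ - 4) = (θ - 4)`** (`N = 205`). [folklore] -/
theorem P5_mul_P41a_twentytwo (hθ : aeval θ (csPoly 22) = 0) :
    span {(5 : 𝓞 K), thetaInt hθ - 4} * span {(41 : 𝓞 K), thetaInt hθ - 4} =
      span {thetaInt hθ - 4} := by
  have rel := thetaInt_rel_twentytwo hθ
  set t := thetaInt hθ with ht
  exact span_pair_mul_span_pair_eq_span_singleton
    (δ₁ := t ^ 2 - 18 * t - 51) (δ₂ := 5)
    (δ₃ := 41) (δ₄ := t - 4)
    (u₁ := 0) (u₂ := -8) (u₃ := 1) (u₄ := 0)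
    (by linear_combination (-1 : 𝓞 K) * rel) (by ring)
    (by ring) (by ring)
    (by ring)

/-- **`𝔭₁₁ (41, θ - 6) = (θ - 6)`** (`N = 451`). [folklore] -/
theorem P11_mul_P41b_twentytwo (hθ : aeval θ (csPoly 22) = 0) :
    span {(11 : 𝓞 K), thetaInt hθ - 6} * span {(41 : 𝓞 K), thetaInt hθ - 6} =
      span {thetaInt hθ - 6} := by
  have rel := thetaInt_rel_twentytwo hθ
  set t := thetaInt hθ with ht
  exact span_pair_mul_span_pair_eq_span_singleton
    (δ₁ := t ^ 2 - 16 * t - 75) (δ₂ := 11)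
    (δ₃ := 41) (δ₄ := t - 6)
    (u₁ := 0) (u₂ := 15) (u₃ := -4) (u₄ := 0)
    (by linear_combination (-1 : 𝓞 K) * rel) (by ring)
    (by ring) (by ring)
    (by ring)

/-- **`𝔭₁₇ (41, θ - 12) = (2θ² - 1)`** (`N = -697`). [folklore] -/
theorem P17_mul_P41c_twentytwo (hθ : aeval θ (csPoly 22) = 0) :
    span {(17 : 𝓞 K), thetaInt hθ - 14} * span {(41 : 𝓞 K), thetaInt hθ - 12} =
      span {2 * thetaInt hθ ^ 2 - 1} := by
  have rel := thetaInt_rel_twentytwo hθ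
  set t := thetaInt hθ with ht
  exact span_pair_mul_span_pair_eq_span_singleton
    (δ₁ := -86 * t ^ 2 + 1844 * t - 793) (δ₂ := 24 * t ^ 2 - 515 * t + 230)
    (δ₃ := 68 * t ^ 2 - 1459 * t + 648) (δ₄ := -19 * t ^ 2 + 408 * t - 188)
    (u₁ := 1) (u₂ := -9) (u₃ := 5) (u₄ := 2)
    (by linear_combination (172 * t + 96) * rel) (by linear_combination (-48 * t - 26) * rel)
    (by linear_combination (-136 * t - 74) * rel) (by linear_combination (38 * t + 20) * rel)
    (by ring)

/-- **`𝔭₅ 𝔭₆₁ = (θ² - 3θ + 1)`** (`N = -305`). [folklore] -/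
theorem P5_mul_P61_twentytwo (hθ : aeval θ (csPoly 22) = 0) :
    span {(5 : 𝓞 K), thetaInt hθ - 4} * span {(61 : 𝓞 K), thetaInt hθ - 45} =
      span {thetaInt hθ ^ 2 - 3 * thetaInt hθ + 1} := by
  have rel := thetaInt_rel_twentytwo hθ
  set t := thetaInt hθ with ht
  exact span_pair_mul_span_pair_eq_span_singleton
    (δ₁ := 37 * t ^ 2 - 796 * t + 398) (δ₂ := -27 * t ^ 2 + 581 * t - 293)
    (δ₃ := -26 * t ^ 2 + 561 * t - 311) (δ₄ := 19 * t ^ 2 - 410 * t + 229)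
    (u₁ := -2) (u₂ := -3) (u₃ := 1) (u₄ := 1)
    (by linear_combination (-37 * t + 93) * rel) (by linear_combination (27 * t - 68) * rel)
    (by linear_combination (26 * t - 67) * rel) (by linear_combination (-19 * t + 49) * rel)
    (by ring)

/-- **`𝔭₁₇ 𝔭₆₇ = (2θ² - 5θ + 1)`** (`N = -1139`). [folklore] -/
theorem P17_mul_P67_twentytwo (hθ : aeval θ (csPoly 22) = 0) :
    span {(17 : 𝓞 K), thetaInt hθ - 14} * span {(67 : 𝓞 K), thetaInt hθ - 43} =
      span {2 * thetaInt hθ ^ 2 - 5 * thetaInt hθ + 1} := by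
  have rel := thetaInt_rel_twentytwo hθ
  set t := thetaInt hθ with ht
  exact span_pair_mul_span_pair_eq_span_singleton
    (δ₁ := 113 * t ^ 2 - 2451 * t + 1634) (δ₂ := -72 * t ^ 2 + 1562 * t - 1047)
    (δ₃ := -91 * t ^ 2 + 1975 * t - 1339) (δ₄ := 58 * t ^ 2 - 1259 * t + 858)
    (u₁ := 15) (u₂ := 34) (u₃ := -7) (u₄ := 2)
    (by linear_combination (-226 * t + 495) * rel) (by linear_combination (144 * t - 316) * rel)
    (by linear_combination (182 * t - 401) * rel) (by linear_combination (-116 * t + 256) * rel)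
    (by ring)

/-- **`𝔭₁₁ 𝔭₇₁ = (θ + 5)`** (`N = 781`). [folklore] -/
theorem P11_mul_P71_twentytwo (hθ : aeval θ (csPoly 22) = 0) :
    span {(11 : 𝓞 K), thetaInt hθ - 6} * span {(71 : 𝓞 K), thetaInt hθ - 66} =
      span {thetaInt hθ + 5} := by
  have rel := thetaInt_rel_twentytwo hθ
  set t := thetaInt hθ with ht
  exact span_pair_mul_span_pair_eq_span_singleton
    (δ₁ := t ^ 2 - 27 * t + 156) (δ₂ := -t ^ 2 + 27 * t - 145)
    (δ₃ := -t ^ 2 + 27 * t - 85) (δ₄ := t ^ 2 - 26 * t + 79)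
    (u₁ := 11) (u₂ := 13) (u₃ := -2) (u₄ := 0)
    (by linear_combination (-1 : 𝓞 K) * rel) (by linear_combination (1 : 𝓞 K) * rel)
    (by linear_combination (1 : 𝓞 K) * rel) (by linear_combination (-1 : 𝓞 K) * rel)
    (by ring)

/-- **`𝔭₁₉ 𝔭₇₃ = (θ² + θ + 1)`** (`N = 1387`). [folklore] -/
theorem P19_mul_P73_twentytwo (hθ : aeval θ (csPoly 22) = 0) :
    span {(19 : 𝓞 K), thetaInt hθ - 7} * span {(73 : 𝓞 K), thetaInt hθ - 64} =
      span {thetaInt hθ ^ 2 + thetaInt hθ + 1} := by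
  have rel := thetaInt_rel_twentytwo hθ
  set t := thetaInt hθ with ht
  exact span_pair_mul_span_pair_eq_span_singleton
    (δ₁ := 43 * t ^ 2 - 968 * t + 1366) (δ₂ := -38 * t ^ 2 + 855 * t - 1197)
    (δ₃ := -17 * t ^ 2 + 381 * t - 501) (δ₄ := 15 * t ^ 2 - 336 * t + 439)
    (u₁ := 18) (u₂ := 23) (u₃ := -5) (u₄ := 1)
    (by linear_combination (-43 * t - 21) * rel) (by linear_combination (38 * t + 19) * rel)
    (by linear_combination (17 * t + 10) * rel) (by linear_combination (-15 * t - 9) * rel)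
    (by ring)

/-- **`𝔭₁₃ (97, θ - 15) = (θ - 15)`** (`N = 1261`). [folklore] -/
theorem P13_mul_P97a_twentytwo (hθ : aeval θ (csPoly 22) = 0) :
    span {(13 : 𝓞 K), thetaInt hθ - 2} * span {(97 : 𝓞 K), thetaInt hθ - 15} =
      span {thetaInt hθ - 15} := by
  have rel := thetaInt_rel_twentytwo hθ
  set t := thetaInt hθ with ht
  exact span_pair_mul_span_pair_eq_span_singleton
    (δ₁ := t ^ 2 - 7 * t - 84) (δ₂ := 13)
    (δ₃ := t ^ 2 - 7 * t + 13) (δ₄ := t - 2)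
    (u₁ := 2) (u₂ := 15) (u₃ := -2) (u₄ := 0)
    (by linear_combination (-1 : 𝓞 K) * rel) (by ring)
    (by linear_combination (-1 : 𝓞 K) * rel) (by ring)
    (by ring)

/-- **`𝔭₃ (97, θ - 39) = (5θ - 1)`** (`N = -291`). [folklore] -/
theorem P3_mul_P97b_twentytwo (hθ : aeval θ (csPoly 22) = 0) :
    span {(3 : 𝓞 K), thetaInt hθ - 8} * span {(97 : 𝓞 K), thetaInt hθ - 39} =
      span {5 * thetaInt hθ - 1} := by
  have rel := thetaInt_rel_twentytwo hθ
  set t := thetaInt hθ with ht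
  exact span_pair_mul_span_pair_eq_span_singleton
    (δ₁ := -25 * t ^ 2 + 545 * t - 416) (δ₂ := 10 * t ^ 2 - 218 * t + 167)
    (δ₃ := 65 * t ^ 2 - 1417 * t + 1101) (δ₄ := -26 * t ^ 2 + 567 * t - 442)
    (u₁ := 11) (u₂ := 34) (u₃ := -1) (u₄ := 0)
    (by linear_combination (125 : 𝓞 K) * rel) (by linear_combination (-50 : 𝓞 K) * rel)
    (by linear_combination (-325 : 𝓞 K) * rel) (by linear_combination (130 : 𝓞 K) * rel)
    (by ring)

/-- **`(97, θ - 65) = (3θ - 1)` is principal** (`N(3θ - 1) = -97`). [folklore] -/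
theorem P97c_eq_twentytwo (hθ : aeval θ (csPoly 22) = 0) :
    span {(97 : 𝓞 K), thetaInt hθ - 65} = span {3 * thetaInt hθ - 1} := by
  have rel := thetaInt_rel_twentytwo hθ
  set t := thetaInt hθ with ht
  exact span_pair_eq_span_singleton (u := 2) (v := 3) (δ := -9 * t ^ 2 + 195 * t - 124)
    (ε := 6 * t ^ 2 - 130 * t + 83)
    (by ring) (by linear_combination (27 : 𝓞 K) * rel) (by linear_combination (-18 : 𝓞 K) * rel)

/-- **`(9, θ - 8) 𝔭₁₀₁ = (14θ - 13)`** (`N = -909 = -9·101`). [folklore] -/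
theorem I2_mul_P101_twentytwo (hθ : aeval θ (csPoly 22) = 0) :
    span {(9 : 𝓞 K), thetaInt hθ - 8} * span {(101 : 𝓞 K), thetaInt hθ - 37} =
      span {14 * thetaInt hθ - 13} := by
  have rel := thetaInt_rel_twentytwo hθ
  set t := thetaInt hθ with ht
  exact span_pair_mul_span_pair_eq_span_singleton
    (δ₁ := -196 * t ^ 2 + 4130 * t - 281) (δ₂ := 70 * t ^ 2 - 1475 * t + 101)
    (δ₃ := 154 * t ^ 2 - 3245 * t + 228) (δ₄ := -55 * t ^ 2 + 1159 * t - 82)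
    (u₁ := 7) (u₂ := 24) (u₃ := -2) (u₄ := 0)
    (by linear_combination (2744 : 𝓞 K) * rel) (by linear_combination (-980 : 𝓞 K) * rel)
    (by linear_combination (-2156 : 𝓞 K) * rel) (by linear_combination (770 : 𝓞 K) * rel)
    (by ring)


/-! ### The class group is generated by `g = [𝔭₃]`, `g⁶ = 1` -/

/-- `(3, θ - 8)` is a nonzero ideal. [folklore] -/
theorem P3_mem_nonZeroDivisors_twentytwo (hθ : aeval θ (csPoly 22) = 0) :
    span {(3 : 𝓞 K), thetaInt hθ - 8} ∈ (Ideal (𝓞 K))⁰ := by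
  have h := span_pair_natCast_mem_nonZeroDivisors (K := K) (n := 3) (by norm_num)
    (thetaInt hθ - 8)
  simp only [Nat.cast_ofNat] at h
  exact h

/-- `(9, θ - 8)` is a nonzero ideal. [folklore] -/
theorem I2_mem_nonZeroDivisors_twentytwo (hθ : aeval θ (csPoly 22) = 0) :
    span {(9 : 𝓞 K), thetaInt hθ - 8} ∈ (Ideal (𝓞 K))⁰ := by
  have h := span_pair_natCast_mem_nonZeroDivisors (K := K) (n := 9) (by norm_num)
    (thetaInt hθ - 8)
  simp only [Nat.cast_ofNat] at h
  exact h

/-- `(27, θ - 8)` is a nonzero ideal. [folklore] -/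
theorem I3_mem_nonZeroDivisors_twentytwo (hθ : aeval θ (csPoly 22) = 0) :
    span {(27 : 𝓞 K), thetaInt hθ - 8} ∈ (Ideal (𝓞 K))⁰ := by
  have h := span_pair_natCast_mem_nonZeroDivisors (K := K) (n := 27) (by norm_num)
    (thetaInt hθ - 8)
  simp only [Nat.cast_ofNat] at h
  exact h

/-- `(5, θ - 4)` is a nonzero ideal. [folklore] -/
theorem P5_mem_nonZeroDivisors_twentytwo (hθ : aeval θ (csPoly 22) = 0) :
    span {(5 : 𝓞 K), thetaInt hθ - 4} ∈ (Ideal (𝓞 K))⁰ := by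
  have h := span_pair_natCast_mem_nonZeroDivisors (K := K) (n := 5) (by norm_num)
    (thetaInt hθ - 4)
  simp only [Nat.cast_ofNat] at h
  exact h

/-- `(11, θ - 6)` is a nonzero ideal. [folklore] -/
theorem P11_mem_nonZeroDivisors_twentytwo (hθ : aeval θ (csPoly 22) = 0) :
    span {(11 : 𝓞 K), thetaInt hθ - 6} ∈ (Ideal (𝓞 K))⁰ := by
  have h := span_pair_natCast_mem_nonZeroDivisors (K := K) (n := 11) (by norm_num)
    (thetaInt hθ - 6)
  simp only [Nat.cast_ofNat] at h
  exact h

/-- **Every ideal class of the trace `22` field is one of `1`, `[𝔭₃]`, `[(9, θ - 8)]`, `[(27, θ - 8)]`,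
`[𝔭₅]`, `[𝔭₁₁]`** — the powers `g⁰, …, g⁵` of `g = [𝔭₃]`, `𝔭₃ = (3, θ - 8)`, `g⁶ = 1` (`𝔭₃ᵏ = (3ᵏ, θ - 8)`,
`𝔭₃⁶ = (θ - 8)`), with `[𝔭₅] = g⁴`, `[𝔭₁₁] = g⁵`; so the class number divides `6`. Proof: `d_K = 142097`,
`⌊M_K⌋ ≤ 106`, Dedekind–Kummer at `p ≤ 106` and the relations listed in the module docstring. [cite: KimYamada2023, §6.1 (proof of Thm. B)] -/
theorem classGroup_mem_six_twentytwo (hθ : aeval θ (csPoly 22) = 0) (h3 : finrank ℚ K = 3)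
    (C : ClassGroup (𝓞 K)) :
    C = 1 ∨ C = ClassGroup.mk0 ⟨span {(3 : 𝓞 K), thetaInt hθ - 8}, P3_mem_nonZeroDivisors_twentytwo hθ⟩ ∨
      C = ClassGroup.mk0 ⟨span {(9 : 𝓞 K), thetaInt hθ - 8}, I2_mem_nonZeroDivisors_twentytwo hθ⟩ ∨
      C = ClassGroup.mk0 ⟨span {(27 : 𝓞 K), thetaInt hθ - 8}, I3_mem_nonZeroDivisors_twentytwo hθ⟩ ∨
      C = ClassGroup.mk0 ⟨span {(5 : 𝓞 K), thetaInt hθ - 4}, P5_mem_nonZeroDivisors_twentytwo hθ⟩ ∨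
      C = ClassGroup.mk0 ⟨span {(11 : 𝓞 K), thetaInt hθ - 6}, P11_mem_nonZeroDivisors_twentytwo hθ⟩ := by
  classical
  have rel := thetaInt_rel_twentytwo hθ
  set t := thetaInt hθ with ht
  have hne : ∀ (x y : 𝓞 K) (n : ℕ), x * y = n → n ≠ 0 → x ≠ 0 := by
    rintro x y n hxy hn rfl
    rw [zero_mul] at hxy
    exact hn (by exact_mod_cast hxy.symm)
  have hne1 : t - 8 ≠ 0 :=
    hne _ (t ^ 2 - 14 * t - 91) 729 (by push_cast; linear_combination (1 : 𝓞 K) * rel)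
      (by norm_num)
  have hne2 : t + 1 ≠ 0 :=
    hne _ (t ^ 2 - 23 * t + 44) 45 (by push_cast; linear_combination (1 : 𝓞 K) * rel)
      (by norm_num)
  have hne3 : 2 * t - 1 ≠ 0 :=
    hne _ (-4 * t ^ 2 + 86 * t - 41) 33 (by push_cast; linear_combination (-8 : 𝓞 K) * rel)
      (by norm_num)
  have hne4 : t - 2 ≠ 0 :=
    hne _ (t ^ 2 - 20 * t - 19) 39 (by push_cast; linear_combination (1 : 𝓞 K) * rel)
      (by norm_num)
  have hne5 : 4 * t - 5 ≠ 0 :=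
    hne _ (16 * t ^ 2 - 332 * t - 79) 459 (by push_cast; linear_combination (64 : 𝓞 K) * rel)
      (by norm_num)
  have hne6 : 3 * t - 2 ≠ 0 :=
    hne _ (-9 * t ^ 2 + 192 * t - 61) 95 (by push_cast; linear_combination (-27 : 𝓞 K) * rel)
      (by norm_num)
  have hne7 : 5 * t - 2 ≠ 0 :=
    hne _ (-25 * t ^ 2 + 540 * t - 309) 493 (by push_cast; linear_combination (-125 : 𝓞 K) * rel)
      (by norm_num)
  have hne8 : 5 * t - 4 ≠ 0 :=
    hne _ (-25 * t ^ 2 + 530 * t - 101) 279 (by push_cast; linear_combination (-125 : 𝓞 K) * rel)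
      (by norm_num)
  have hne9 : 4 * t - 1 ≠ 0 :=
    hne _ (-16 * t ^ 2 + 348 * t - 249) 185 (by push_cast; linear_combination (-64 : 𝓞 K) * rel)
      (by norm_num)
  have hne10 : t - 4 ≠ 0 :=
    hne _ (t ^ 2 - 18 * t - 51) 205 (by push_cast; linear_combination (1 : 𝓞 K) * rel)
      (by norm_num)
  have hne11 : t - 6 ≠ 0 :=
    hne _ (t ^ 2 - 16 * t - 75) 451 (by push_cast; linear_combination (1 : 𝓞 K) * rel)
      (by norm_num)
  have hne12 : 2 * t ^ 2 - 1 ≠ 0 :=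
    hne _ (-86 * t ^ 2 + 1844 * t - 793) 697 (by push_cast; linear_combination (-172 * t - 96) * rel)
      (by norm_num)
  have hne13 : t ^ 2 - 3 * t + 1 ≠ 0 :=
    hne _ (37 * t ^ 2 - 796 * t + 398) 305 (by push_cast; linear_combination (37 * t - 93) * rel)
      (by norm_num)
  have hne14 : 2 * t ^ 2 - 5 * t + 1 ≠ 0 :=
    hne _ (113 * t ^ 2 - 2451 * t + 1634) 1139 (by push_cast; linear_combination (226 * t - 495) * rel)
      (by norm_num)
  have hne15 : t + 5 ≠ 0 :=
    hne _ (t ^ 2 - 27 * t + 156) 781 (by push_cast; linear_combination (1 : 𝓞 K) * rel)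
      (by norm_num)
  have hne16 : t ^ 2 + t + 1 ≠ 0 :=
    hne _ (43 * t ^ 2 - 968 * t + 1366) 1387 (by push_cast; linear_combination (43 * t + 21) * rel)
      (by norm_num)
  have hne17 : t - 15 ≠ 0 :=
    hne _ (t ^ 2 - 7 * t - 84) 1261 (by push_cast; linear_combination (1 : 𝓞 K) * rel)
      (by norm_num)
  have hne18 : 5 * t - 1 ≠ 0 :=
    hne _ (-25 * t ^ 2 + 545 * t - 416) 291 (by push_cast; linear_combination (-125 : 𝓞 K) * rel)
      (by norm_num)
  have hne19 : 14 * t - 13 ≠ 0 :=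
    hne _ (-196 * t ^ 2 + 4130 * t - 281) 909 (by push_cast; linear_combination (-2744 : 𝓞 K) * rel)
      (by norm_num)
  have hinv : ∀ (P Q : Ideal (𝓞 K)) (hP0 : P ∈ (Ideal (𝓞 K))⁰) (hQ0 : Q ∈ (Ideal (𝓞 K))⁰) (x : 𝓞 K),
      x ≠ 0 → P * Q = span {x} → ClassGroup.mk0 ⟨P, hP0⟩ = (ClassGroup.mk0 ⟨Q, hQ0⟩)⁻¹ := by
    intro P Q hP0 hQ0 x hx hPQ
    exact ClassGroup.mk0_eq_mk0_inv_iff.mpr ⟨x, hx, by simpa using hPQ⟩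
  have hnz : ∀ (n : ℕ) (hn : n ≠ 0) (x : 𝓞 K), span {(n : 𝓞 K), x} ∈ (Ideal (𝓞 K))⁰ :=
    fun n hn x => span_pair_natCast_mem_nonZeroDivisors (K := K) hn x
  have hP3 : span {(3 : 𝓞 K), t - 8} ∈ (Ideal (𝓞 K))⁰ := P3_mem_nonZeroDivisors_twentytwo hθ
  have hI2 : span {(9 : 𝓞 K), t - 8} ∈ (Ideal (𝓞 K))⁰ := I2_mem_nonZeroDivisors_twentytwo hθ
  have hI3 : span {(27 : 𝓞 K), t - 8} ∈ (Ideal (𝓞 K))⁰ := I3_mem_nonZeroDivisors_twentytwo hθ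
  have hP5 : span {(5 : 𝓞 K), t - 4} ∈ (Ideal (𝓞 K))⁰ := P5_mem_nonZeroDivisors_twentytwo hθ
  have hP11 : span {(11 : 𝓞 K), t - 6} ∈ (Ideal (𝓞 K))⁰ := P11_mem_nonZeroDivisors_twentytwo hθ
  have hI4 : span {(81 : 𝓞 K), t - 8} ∈ (Ideal (𝓞 K))⁰ := by
    have h := hnz 81 (by norm_num) (t - 8)
    simp only [Nat.cast_ofNat] at h
    exact h
  have hI5 : span {(243 : 𝓞 K), t - 8} ∈ (Ideal (𝓞 K))⁰ := by
    have h := hnz 243 (by norm_num) (t - 8)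
    simp only [Nat.cast_ofNat] at h
    exact h
  have hP13 : span {(13 : 𝓞 K), t - 2} ∈ (Ideal (𝓞 K))⁰ := by
    have h := hnz 13 (by norm_num) (t - 2)
    simp only [Nat.cast_ofNat] at h
    exact h
  have hP17 : span {(17 : 𝓞 K), t - 14} ∈ (Ideal (𝓞 K))⁰ := by
    have h := hnz 17 (by norm_num) (t - 14)
    simp only [Nat.cast_ofNat] at h
    exact h
  have hP19 : span {(19 : 𝓞 K), t - 7} ∈ (Ideal (𝓞 K))⁰ := by
    have h := hnz 19 (by norm_num) (t - 7)
    simp only [Nat.cast_ofNat] at h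
    exact h
  set g : ClassGroup (𝓞 K) := ClassGroup.mk0 ⟨span {(3 : 𝓞 K), t - 8}, hP3⟩ with hg
  -- the power chain `gᵏ = [(3ᵏ, θ - 8)]`, `g⁶ = 1`
  have hmulcls : ∀ (P Q R : Ideal (𝓞 K)) (hP0 : P ∈ (Ideal (𝓞 K))⁰) (hQ0 : Q ∈ (Ideal (𝓞 K))⁰)
      (hR0 : R ∈ (Ideal (𝓞 K))⁰), P * Q = R →
        ClassGroup.mk0 ⟨P, hP0⟩ * ClassGroup.mk0 ⟨Q, hQ0⟩ = ClassGroup.mk0 ⟨R, hR0⟩ := by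
    intro P Q R hP0 hQ0 hR0 hPQ
    rw [← map_mul]
    congr 1
    exact Subtype.ext (by simpa using hPQ)
  have h2cls : ClassGroup.mk0 ⟨span {(9 : 𝓞 K), t - 8}, hI2⟩ = g ^ (2 : ℤ) := by
    rw [zpow_two, hg, hmulcls _ _ _ hP3 hP3 hI2 (P3_mul_P3_twentytwo hθ)]
  have h3cls : ClassGroup.mk0 ⟨span {(27 : 𝓞 K), t - 8}, hI3⟩ = g ^ (3 : ℤ) := by
    rw [show (3 : ℤ) = 1 + 2 by norm_num, zpow_add, zpow_one, ← h2cls, hg,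
      hmulcls _ _ _ hP3 hI2 hI3 (P3_mul_I2_twentytwo hθ)]
  have h4cls : ClassGroup.mk0 ⟨span {(81 : 𝓞 K), t - 8}, hI4⟩ = g ^ (4 : ℤ) := by
    rw [show (4 : ℤ) = 1 + 3 by norm_num, zpow_add, zpow_one, ← h3cls, hg,
      hmulcls _ _ _ hP3 hI3 hI4 (P3_mul_I3_twentytwo hθ)]
  have h5cls' : ClassGroup.mk0 ⟨span {(243 : 𝓞 K), t - 8}, hI5⟩ = g ^ (5 : ℤ) := by
    rw [show (5 : ℤ) = 1 + 4 by norm_num, zpow_add, zpow_one, ← h4cls, hg,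
      hmulcls _ _ _ hP3 hI4 hI5 (P3_mul_I4_twentytwo hθ)]
  have hg6 : g ^ (6 : ℤ) = 1 := by
    have h : g = (ClassGroup.mk0 ⟨span {(243 : 𝓞 K), t - 8}, hI5⟩)⁻¹ :=
      hinv _ _ hP3 hI5 _ hne1 (P3_mul_I5_twentytwo hθ)
    rw [h5cls'] at h
    rw [show (6 : ℤ) = 1 + 5 by norm_num, zpow_add, zpow_one]
    nth_rewrite 1 [h]
    rw [inv_mul_cancel]
  have hginv : g⁻¹ = g ^ (5 : ℤ) := by
    rw [eq_comm, ← mul_eq_one_iff_eq_inv, ← zpow_add_one, show (5 : ℤ) + 1 = 6 by norm_num, hg6]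
  -- classes of the auxiliary primes
  have h5cls : ClassGroup.mk0 ⟨span {(5 : 𝓞 K), t - 4}, hP5⟩ = (g ^ (2 : ℤ))⁻¹ := by
    rw [← h2cls]
    exact hinv _ _ hP5 hI2 _ hne2 (by rw [mul_comm]; exact I2_mul_P5_twentytwo hθ)
  have h11cls : ClassGroup.mk0 ⟨span {(11 : 𝓞 K), t - 6}, hP11⟩ = g⁻¹ :=
    hinv _ _ hP11 hP3 _ hne3 (by rw [mul_comm]; exact P3_mul_P11_twentytwo hθ)
  have h13cls : ClassGroup.mk0 ⟨span {(13 : 𝓞 K), t - 2}, hP13⟩ = g⁻¹ :=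
    hinv _ _ hP13 hP3 _ hne4 (by rw [mul_comm]; exact P3_mul_P13_twentytwo hθ)
  have h17cls : ClassGroup.mk0 ⟨span {(17 : 𝓞 K), t - 14}, hP17⟩ = (g ^ (3 : ℤ))⁻¹ := by
    rw [← h3cls]
    exact hinv _ _ hP17 hI3 _ hne5 (by rw [mul_comm]; exact I3_mul_P17_twentytwo hθ)
  have h19cls : ClassGroup.mk0 ⟨span {(19 : 𝓞 K), t - 7}, hP19⟩ = g ^ (2 : ℤ) := by
    rw [hinv _ _ hP19 hP5 _ hne6 (by rw [mul_comm]; exact P5_mul_P19_twentytwo hθ), h5cls, inv_inv]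
  let H : Subgroup (ClassGroup (𝓞 K)) := Subgroup.zpowers g
  have hprinc : ∀ (P : Ideal (𝓞 K)) (hP0 : P ∈ (Ideal (𝓞 K))⁰) (x : 𝓞 K), P = span {x} →
      ClassGroup.mk0 ⟨P, hP0⟩ ∈ H := by
    intro P hP0 x hPx
    have : ClassGroup.mk0 ⟨P, hP0⟩ = 1 :=
      (ClassGroup.mk0_eq_one_iff hP0).mpr ⟨⟨x, by rw [hPx, submodule_span_eq]⟩⟩
    rw [this]
    exact H.one_mem
  -- Minkowski: `⌊M_K⌋ ≤ 106`
  have hd : ((|NumberField.discr K| : ℤ) : ℝ) ≤ (142097 : ℕ) := by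
    rw [discr_eq_twentytwo hθ h3]
    norm_num
  have hfloor := floor_minkowskiBound_le_cubic h3 hd (s := 377) (U := 106) (by norm_num)
    (by norm_num) (by norm_num)
  have htop : H = ⊤ := by
    refine classGroup_subgroup_eq_top_of_primesOver H hfloor fun p hp hprime P hP0 hP hle => ?_
    have hpU : p ≤ 106 := (Finset.mem_Icc.mp hp).2
    have h1p : 1 ≤ p := (Finset.mem_Icc.mp hp).1
    interval_cases p
    · exact absurd hprime (by decide)
    · exact hprinc P hP0 _ (eq_span_of_inert_twentytwo hθ h3 (by norm_num) hP)
    · -- `p = 3`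
      rcases eq_P3_or_eq_Q3_twentytwo hθ h3 hP with h | h <;> subst h
      · exact Subgroup.mem_zpowers g
      · rw [hinv _ _ hP0 hP3 3 (by norm_num) (by rw [mul_comm]; exact P3_mul_Q3_twentytwo hθ)]
        exact H.inv_mem (Subgroup.mem_zpowers g)
    · exact absurd hprime (by decide)
    · -- `p = 5`
      rcases eq_P5_or_eq_Q5_twentytwo hθ h3 hP with h | h <;> subst h
      · rw [show ClassGroup.mk0 ⟨_, hP0⟩ = ClassGroup.mk0 ⟨_, hP5⟩ from rfl, h5cls]
        exact H.inv_mem (Subgroup.zpow_mem_zpowers g _)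
      · rw [hinv _ _ hP0 hP5 5 (by norm_num) (by rw [mul_comm]; exact P5_mul_Q5_twentytwo hθ), h5cls, inv_inv]
        exact Subgroup.zpow_mem_zpowers g _
    · exact absurd hprime (by decide)
    · exact hprinc P hP0 _ (eq_span_of_inert_twentytwo hθ h3 (by norm_num) hP)
    · exact absurd hprime (by decide)
    · exact absurd hprime (by decide)
    · exact absurd hprime (by decide)
    · -- `p = 11`
      have h := eq_span_pair_of_unique_root_twentytwo hθ h3 (Or.inl ⟨rfl, rfl⟩) hP hle
      simp only [Nat.cast_ofNat, Int.cast_ofNat] at h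
      subst h
      rw [show ClassGroup.mk0 ⟨_, hP0⟩ = ClassGroup.mk0 ⟨_, hP11⟩ from rfl, h11cls]
      exact H.inv_mem (Subgroup.mem_zpowers g)
    · exact absurd hprime (by decide)
    · -- `p = 13`
      have h := eq_span_pair_of_unique_root_twentytwo hθ h3 (Or.inr (Or.inl ⟨rfl, rfl⟩)) hP hle
      simp only [Nat.cast_ofNat, Int.cast_ofNat] at h
      subst h
      rw [show ClassGroup.mk0 ⟨_, hP0⟩ = ClassGroup.mk0 ⟨_, hP13⟩ from rfl, h13cls]
      exact H.inv_mem (Subgroup.mem_zpowers g)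
    · exact absurd hprime (by decide)
    · exact absurd hprime (by decide)
    · exact absurd hprime (by decide)
    · -- `p = 17`
      have h := eq_span_pair_of_unique_root_twentytwo hθ h3 (Or.inr (Or.inr (Or.inl ⟨rfl, rfl⟩))) hP hle
      simp only [Nat.cast_ofNat, Int.cast_ofNat] at h
      subst h
      rw [show ClassGroup.mk0 ⟨_, hP0⟩ = ClassGroup.mk0 ⟨_, hP17⟩ from rfl, h17cls]
      exact H.inv_mem (Subgroup.zpow_mem_zpowers g _)
    · exact absurd hprime (by decide)
    · -- `p = 19`
      have h := eq_span_pair_of_unique_root_twentytwo hθ h3 (Or.inr (Or.inr (Or.inr (Or.inl ⟨rfl, rfl⟩)))) hP hle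
      simp only [Nat.cast_ofNat, Int.cast_ofNat] at h
      subst h
      rw [show ClassGroup.mk0 ⟨_, hP0⟩ = ClassGroup.mk0 ⟨_, hP19⟩ from rfl, h19cls]
      exact Subgroup.zpow_mem_zpowers g _
    · exact absurd hprime (by decide)
    · exact absurd hprime (by decide)
    · exact absurd hprime (by decide)
    · exact hprinc P hP0 _ (eq_span_of_inert_twentytwo hθ h3 (by norm_num) hP)
    · exact absurd hprime (by decide)
    · exact absurd hprime (by decide)
    · exact absurd hprime (by decide)
    · exact absurd hprime (by decide)
    · exact absurd hprime (by decide)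
    · -- `p = 29`
      have h := eq_span_pair_of_unique_root_twentytwo hθ h3 (Or.inr (Or.inr (Or.inr (Or.inr (Or.inl ⟨rfl, rfl⟩))))) hP hle
      simp only [Nat.cast_ofNat, Int.cast_ofNat] at h
      subst h
      rw [hinv _ _ hP0 hP17 _ hne7 (by rw [mul_comm]; exact P17_mul_P29_twentytwo hθ), h17cls, inv_inv]
      exact Subgroup.zpow_mem_zpowers g _
    · exact absurd hprime (by decide)
    · -- `p = 31`
      have h := eq_span_pair_of_unique_root_twentytwo hθ h3 (Or.inr (Or.inr (Or.inr (Or.inr (Or.inr (Or.inl ⟨rfl, rfl⟩)))))) hP hle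
      simp only [Nat.cast_ofNat, Int.cast_ofNat] at h
      subst h
      rw [hinv _ _ hP0 hI2 _ hne8 (by rw [mul_comm]; exact I2_mul_P31_twentytwo hθ), h2cls]
      exact H.inv_mem (Subgroup.zpow_mem_zpowers g _)
    · exact absurd hprime (by decide)
    · exact absurd hprime (by decide)
    · exact absurd hprime (by decide)
    · exact absurd hprime (by decide)
    · exact absurd hprime (by decide)
    · -- `p = 37`
      have h := eq_span_pair_of_unique_root_twentytwo hθ h3 (Or.inr (Or.inr (Or.inr (Or.inr (Or.inr (Or.inr (Or.inl ⟨rfl, rfl⟩))))))) hP hle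
      simp only [Nat.cast_ofNat, Int.cast_ofNat] at h
      subst h
      rw [hinv _ _ hP0 hP5 _ hne9 (by rw [mul_comm]; exact P5_mul_P37_twentytwo hθ), h5cls, inv_inv]
      exact Subgroup.zpow_mem_zpowers g _
    · exact absurd hprime (by decide)
    · exact absurd hprime (by decide)
    · exact absurd hprime (by decide)
    · -- `p = 41` (splits)
      rcases eq_P41_twentytwo hθ h3 hP with h | h | h <;> subst h
      · rw [hinv _ _ hP0 hP5 _ hne10 (by rw [mul_comm]; exact P5_mul_P41a_twentytwo hθ), h5cls, inv_inv]
        exact Subgroup.zpow_mem_zpowers g _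
      · rw [hinv _ _ hP0 hP11 _ hne11 (by rw [mul_comm]; exact P11_mul_P41b_twentytwo hθ), h11cls, inv_inv]
        exact Subgroup.mem_zpowers g
      · rw [hinv _ _ hP0 hP17 _ hne12 (by rw [mul_comm]; exact P17_mul_P41c_twentytwo hθ), h17cls, inv_inv]
        exact Subgroup.zpow_mem_zpowers g _
    · exact absurd hprime (by decide)
    · exact hprinc P hP0 _ (eq_span_of_inert_twentytwo hθ h3 (by norm_num) hP)
    · exact absurd hprime (by decide)
    · exact absurd hprime (by decide)
    · exact absurd hprime (by decide)
    · exact hprinc P hP0 _ (eq_span_of_inert_twentytwo hθ h3 (by norm_num) hP)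
    · exact absurd hprime (by decide)
    · exact absurd hprime (by decide)
    · exact absurd hprime (by decide)
    · exact absurd hprime (by decide)
    · exact absurd hprime (by decide)
    · exact hprinc P hP0 _ (eq_span_of_inert_twentytwo hθ h3 (by norm_num) hP)
    · exact absurd hprime (by decide)
    · exact absurd hprime (by decide)
    · exact absurd hprime (by decide)
    · exact absurd hprime (by decide)
    · exact absurd hprime (by decide)
    · exact hprinc P hP0 _ (eq_span_of_inert_twentytwo hθ h3 (by norm_num) hP)
    · exact absurd hprime (by decide)
    · -- `p = 61`
      have h := eq_span_pair_of_unique_root_twentytwo hθ h3 (Or.inr (Or.inr (Or.inr (Or.inr (Or.inr (Or.inr (Or.inr (Or.inl ⟨rfl, rfl⟩)))))))) hP hle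
      simp only [Nat.cast_ofNat, Int.cast_ofNat] at h
      subst h
      rw [hinv _ _ hP0 hP5 _ hne13 (by rw [mul_comm]; exact P5_mul_P61_twentytwo hθ), h5cls, inv_inv]
      exact Subgroup.zpow_mem_zpowers g _
    · exact absurd hprime (by decide)
    · exact absurd hprime (by decide)
    · exact absurd hprime (by decide)
    · exact absurd hprime (by decide)
    · exact absurd hprime (by decide)
    · -- `p = 67`
      have h := eq_span_pair_of_unique_root_twentytwo hθ h3 (Or.inr (Or.inr (Or.inr (Or.inr (Or.inr (Or.inr (Or.inr (Or.inr (Or.inl ⟨rfl, rfl⟩))))))))) hP hle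
      simp only [Nat.cast_ofNat, Int.cast_ofNat] at h
      subst h
      rw [hinv _ _ hP0 hP17 _ hne14 (by rw [mul_comm]; exact P17_mul_P67_twentytwo hθ), h17cls, inv_inv]
      exact Subgroup.zpow_mem_zpowers g _
    · exact absurd hprime (by decide)
    · exact absurd hprime (by decide)
    · exact absurd hprime (by decide)
    · -- `p = 71`
      have h := eq_span_pair_of_unique_root_twentytwo hθ h3 (Or.inr (Or.inr (Or.inr (Or.inr (Or.inr (Or.inr (Or.inr (Or.inr (Or.inr (Or.inl ⟨rfl, rfl⟩)))))))))) hP hle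
      simp only [Nat.cast_ofNat, Int.cast_ofNat] at h
      subst h
      rw [hinv _ _ hP0 hP11 _ hne15 (by rw [mul_comm]; exact P11_mul_P71_twentytwo hθ), h11cls, inv_inv]
      exact Subgroup.mem_zpowers g
    · exact absurd hprime (by decide)
    · -- `p = 73`
      have h := eq_span_pair_of_unique_root_twentytwo hθ h3 (Or.inr (Or.inr (Or.inr (Or.inr (Or.inr (Or.inr (Or.inr (Or.inr (Or.inr (Or.inr (Or.inl ⟨rfl, rfl⟩))))))))))) hP hle
      simp only [Nat.cast_ofNat, Int.cast_ofNat] at h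
      subst h
      rw [hinv _ _ hP0 hP19 _ hne16 (by rw [mul_comm]; exact P19_mul_P73_twentytwo hθ), h19cls]
      exact H.inv_mem (Subgroup.zpow_mem_zpowers g _)
    · exact absurd hprime (by decide)
    · exact absurd hprime (by decide)
    · exact absurd hprime (by decide)
    · exact absurd hprime (by decide)
    · exact absurd hprime (by decide)
    · exact hprinc P hP0 _ (eq_span_of_inert_twentytwo hθ h3 (by norm_num) hP)
    · exact absurd hprime (by decide)
    · exact absurd hprime (by decide)
    · exact absurd hprime (by decide)
    · exact hprinc P hP0 _ (eq_span_of_inert_twentytwo hθ h3 (by norm_num) hP)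
    · exact absurd hprime (by decide)
    · exact absurd hprime (by decide)
    · exact absurd hprime (by decide)
    · exact absurd hprime (by decide)
    · exact absurd hprime (by decide)
    · exact hprinc P hP0 _ (eq_span_of_inert_twentytwo hθ h3 (by norm_num) hP)
    · exact absurd hprime (by decide)
    · exact absurd hprime (by decide)
    · exact absurd hprime (by decide)
    · exact absurd hprime (by decide)
    · exact absurd hprime (by decide)
    · exact absurd hprime (by decide)
    · exact absurd hprime (by decide)
    · -- `p = 97` (splits)
      rcases eq_P97_twentytwo hθ h3 hP with h | h | h <;> subst h
      · rw [hinv _ _ hP0 hP13 _ hne17 (by rw [mul_comm]; exact P13_mul_P97a_twentytwo hθ), h13cls, inv_inv]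
        exact Subgroup.mem_zpowers g
      · rw [hinv _ _ hP0 hP3 _ hne18 (by rw [mul_comm]; exact P3_mul_P97b_twentytwo hθ)]
        exact H.inv_mem (Subgroup.mem_zpowers g)
      · exact hprinc _ hP0 _ (P97c_eq_twentytwo hθ)
    · exact absurd hprime (by decide)
    · exact absurd hprime (by decide)
    · exact absurd hprime (by decide)
    · -- `p = 101`
      have h := eq_span_pair_of_unique_root_twentytwo hθ h3 (Or.inr (Or.inr (Or.inr (Or.inr (Or.inr (Or.inr (Or.inr (Or.inr (Or.inr (Or.inr (Or.inr (⟨rfl, rfl⟩)))))))))))) hP hle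
      simp only [Nat.cast_ofNat, Int.cast_ofNat] at h
      subst h
      rw [hinv _ _ hP0 hI2 _ hne19 (by rw [mul_comm]; exact I2_mul_P101_twentytwo hθ), h2cls]
      exact H.inv_mem (Subgroup.zpow_mem_zpowers g _)
    · exact absurd hprime (by decide)
    · exact hprinc P hP0 _ (eq_span_of_inert_twentytwo hθ h3 (by norm_num) hP)
    · exact absurd hprime (by decide)
    · exact absurd hprime (by decide)
    · exact absurd hprime (by decide)
  have hC : C ∈ H := by rw [htop]; exact Subgroup.mem_top C
  obtain ⟨k, rfl⟩ := Subgroup.mem_zpowers_iff.mp hC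
  obtain ⟨q, r, hr, rfl⟩ : ∃ q r : ℤ, (r = 0 ∨ r = 1 ∨ r = 2 ∨ r = 3 ∨ r = 4 ∨ r = 5) ∧ k = 6 * q + r :=
    ⟨k / 6, k % 6, by omega, by omega⟩
  rw [zpow_add, zpow_mul, hg6, one_zpow, one_mul]
  rcases hr with rfl | rfl | rfl | rfl | rfl | rfl
  · exact Or.inl (zpow_zero g)
  · right; left
    rw [zpow_one]
  · right; right; left
    rw [← h2cls]
  · right; right; right; left
    rw [← h3cls]
  · right; right; right; right; left
    have : g ^ (4 : ℤ) = (g ^ (2 : ℤ))⁻¹ := by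
      rw [eq_inv_iff_mul_eq_one, ← zpow_add, show (4 : ℤ) + 2 = 6 by norm_num, hg6]
    rw [this, ← h5cls]
  · right; right; right; right; right
    rw [← hginv, ← h11cls]


end Field


/-! ### The ideal classes of `ℤ[X]/(f₂₂)` and Gompf's conjecture for the traces `22` and `-17` -/

section Matrices

/-- **The ideal classes of `ℤ[Θ₂₂] = ℤ[X]/(f₂₂)`**: every non-zero ideal is in the class of one of
`⟨Θ - 1, 1⟩`, `⟨Θ - 8, 3⟩`, `⟨Θ - 8, 9⟩`, `⟨Θ - 8, 27⟩`, `⟨Θ - 4, 5⟩`, `⟨Θ - 6, 11⟩` (six representatives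
cover `C(ℤ[Θ₂₂])`). [cite: KimYamada2023, §6.1 (proof of Thm. B)] -/
theorem ideal_class_adjoinRoot_twentytwo (J : Ideal (AdjoinRoot (csPoly 22))) (hJ : J ≠ ⊥) :
    ∃ x y : AdjoinRoot (csPoly 22), x ≠ 0 ∧ y ≠ 0 ∧
      (span {x} * J = span {y} * csIdeal 1 1 22 ∨ span {x} * J = span {y} * csIdeal 8 3 22 ∨ span {x} * J = span {y} * csIdeal 8 9 22 ∨ span {x} * J = span {y} * csIdeal 8 27 22 ∨ span {x} * J = span {y} * csIdeal 4 5 22 ∨ span {x} * J = span {y} * csIdeal 6 11 22) := by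
  classical
  set θ' := AdjoinRoot.root (csPolyQ 22) with hθ'
  have hθ : aeval θ' (csPoly 22) = 0 := aeval_root_csPoly 22
  have h3 : finrank ℚ (CSField 22) = 3 := finrank_CSField 22
  obtain ⟨e, he⟩ := exists_ringEquiv_adjoinRoot_of_sq hθ h3 csDisc_twentytwo_sq
  set I : Ideal (𝓞 (CSField 22)) := J.map e with hI
  have hIJ : I.map (e.symm : 𝓞 (CSField 22) →+* AdjoinRoot (csPoly 22)) = J := by
    rw [hI]
    exact Ideal.map_of_equiv e (I := J)
  have hI0 : I ≠ ⊥ := by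
    intro h0
    apply hJ
    rw [← hIJ, h0, Ideal.map_bot]
  have hImem : I ∈ (Ideal (𝓞 (CSField 22)))⁰ := mem_nonZeroDivisors_iff_ne_zero.mpr hI0
  have hsymm : ∀ x, (e.symm : 𝓞 (CSField 22) →+* AdjoinRoot (csPoly 22)) (e x) = x :=
    fun x => e.symm_apply_apply x
  have hP3 : (span {(3 : 𝓞 (CSField 22)), thetaInt hθ - 8}).map
      (e.symm : 𝓞 (CSField 22) →+* AdjoinRoot (csPoly 22)) = csIdeal 8 3 22 := by
    rw [Ideal.map_span, Set.image_insert_eq, Set.image_singleton, map_sub, ← he, hsymm, map_ofNat,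
      map_ofNat, csIdeal, Set.pair_comm]
    simp
  have hI2 : (span {(9 : 𝓞 (CSField 22)), thetaInt hθ - 8}).map
      (e.symm : 𝓞 (CSField 22) →+* AdjoinRoot (csPoly 22)) = csIdeal 8 9 22 := by
    rw [Ideal.map_span, Set.image_insert_eq, Set.image_singleton, map_sub, ← he, hsymm, map_ofNat,
      map_ofNat, csIdeal, Set.pair_comm]
    simp
  have hI3 : (span {(27 : 𝓞 (CSField 22)), thetaInt hθ - 8}).map
      (e.symm : 𝓞 (CSField 22) →+* AdjoinRoot (csPoly 22)) = csIdeal 8 27 22 := by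
    rw [Ideal.map_span, Set.image_insert_eq, Set.image_singleton, map_sub, ← he, hsymm, map_ofNat,
      map_ofNat, csIdeal, Set.pair_comm]
    simp
  have hP5 : (span {(5 : 𝓞 (CSField 22)), thetaInt hθ - 4}).map
      (e.symm : 𝓞 (CSField 22) →+* AdjoinRoot (csPoly 22)) = csIdeal 4 5 22 := by
    rw [Ideal.map_span, Set.image_insert_eq, Set.image_singleton, map_sub, ← he, hsymm, map_ofNat,
      map_ofNat, csIdeal, Set.pair_comm]
    simp
  have hP11 : (span {(11 : 𝓞 (CSField 22)), thetaInt hθ - 6}).map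
      (e.symm : 𝓞 (CSField 22) →+* AdjoinRoot (csPoly 22)) = csIdeal 6 11 22 := by
    rw [Ideal.map_span, Set.image_insert_eq, Set.image_singleton, map_sub, ← he, hsymm, map_ofNat,
      map_ofNat, csIdeal, Set.pair_comm]
    simp
  have hcase : ∀ (P : Ideal (𝓞 (CSField 22))) (hP0 : P ∈ (Ideal (𝓞 (CSField 22)))⁰)
      (Q : Ideal (AdjoinRoot (csPoly 22))),
      P.map (e.symm : 𝓞 (CSField 22) →+* AdjoinRoot (csPoly 22)) = Q →
      ClassGroup.mk0 ⟨I, hImem⟩ = ClassGroup.mk0 ⟨P, hP0⟩ →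
        ∃ x y : AdjoinRoot (csPoly 22), x ≠ 0 ∧ y ≠ 0 ∧ span {x} * J = span {y} * Q := by
    intro P hP0 Q hPQ hcls
    obtain ⟨x, y, hx, hy, hxy⟩ := ClassGroup.mk0_eq_mk0_iff.mp hcls
    refine ⟨(e.symm : 𝓞 (CSField 22) →+* AdjoinRoot (csPoly 22)) x,
      (e.symm : 𝓞 (CSField 22) →+* AdjoinRoot (csPoly 22)) y,
      (map_ne_zero_iff _ e.symm.injective).mpr hx, (map_ne_zero_iff _ e.symm.injective).mpr hy, ?_⟩
    have h := congrArg (Ideal.map (e.symm : 𝓞 (CSField 22) →+* AdjoinRoot (csPoly 22))) hxy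
    simp only [Ideal.map_mul, Ideal.map_span, Set.image_singleton] at h
    rw [hIJ, hPQ] at h
    exact h
  rcases classGroup_mem_six_twentytwo hθ h3 (ClassGroup.mk0 ⟨I, hImem⟩) with h1 | hcl | hcl | hcl | hcl | hcl
  · obtain ⟨z, hz⟩ := ((ClassGroup.mk0_eq_one_iff hImem).mp h1).principal
    have hz' : I = span {z} := by rw [hz, submodule_span_eq]
    have hz0 : z ≠ 0 := by
      rintro rfl
      apply hI0
      rw [hz', Ideal.span_singleton_eq_bot]
    refine ⟨1, (e.symm : 𝓞 (CSField 22) →+* AdjoinRoot (csPoly 22)) z, one_ne_zero,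
      (map_ne_zero_iff _ e.symm.injective).mpr hz0, Or.inl ?_⟩
    rw [Ideal.span_singleton_one, Ideal.top_mul, csIdeal_one_one, Ideal.mul_top, ← hIJ, hz',
      Ideal.map_span, Set.image_singleton]
  · obtain ⟨x, y, hx, hy, h⟩ := hcase _ _ _ hP3 hcl
    exact ⟨x, y, hx, hy, Or.inr (Or.inl h)⟩
  · obtain ⟨x, y, hx, hy, h⟩ := hcase _ _ _ hI2 hcl
    exact ⟨x, y, hx, hy, Or.inr (Or.inr (Or.inl h))⟩
  · obtain ⟨x, y, hx, hy, h⟩ := hcase _ _ _ hI3 hcl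
    exact ⟨x, y, hx, hy, Or.inr (Or.inr (Or.inr (Or.inl h)))⟩
  · obtain ⟨x, y, hx, hy, h⟩ := hcase _ _ _ hP5 hcl
    exact ⟨x, y, hx, hy, Or.inr (Or.inr (Or.inr (Or.inr (Or.inl h))))⟩
  · obtain ⟨x, y, hx, hy, h⟩ := hcase _ _ _ hP11 hcl
    exact ⟨x, y, hx, hy, Or.inr (Or.inr (Or.inr (Or.inr (Or.inr (h)))))⟩

/-- `3 ∣ f₂₂(8)`: `(8, 3, 22) ∈ 𝒞𝒮`. [cite: KimYamada2023, §6.1 (proof of Thm. B)] -/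
theorem rep0_dvd_eval_csPoly_twentytwo : (3 : ℤ) ∣ (csPoly 22).eval 8 := by
  rw [eval_csPoly]; norm_num

/-- `9 ∣ f₂₂(8)`: `(8, 9, 22) ∈ 𝒞𝒮`. [cite: KimYamada2023, §6.1 (proof of Thm. B)] -/
theorem rep1_dvd_eval_csPoly_twentytwo : (9 : ℤ) ∣ (csPoly 22).eval 8 := by
  rw [eval_csPoly]; norm_num

/-- `27 ∣ f₂₂(8)`: `(8, 27, 22) ∈ 𝒞𝒮`. [cite: KimYamada2023, §6.1 (proof of Thm. B)] -/
theorem rep2_dvd_eval_csPoly_twentytwo : (27 : ℤ) ∣ (csPoly 22).eval 8 := by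
  rw [eval_csPoly]; norm_num

/-- `5 ∣ f₂₂(4)`: `(4, 5, 22) ∈ 𝒞𝒮`. [cite: KimYamada2023, §6.1 (proof of Thm. B)] -/
theorem rep3_dvd_eval_csPoly_twentytwo : (5 : ℤ) ∣ (csPoly 22).eval 4 := by
  rw [eval_csPoly]; norm_num

/-- `11 ∣ f₂₂(6)`: `(6, 11, 22) ∈ 𝒞𝒮`. [cite: KimYamada2023, §6.1 (proof of Thm. B)] -/
theorem rep4_dvd_eval_csPoly_twentytwo : (11 : ℤ) ∣ (csPoly 22).eval 6 := by
  rw [eval_csPoly]; norm_num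

/-- **Every Cappell–Shaneson matrix of trace `22` is similar to one of six standard matrices**
(Prop. 2.14). [cite: KimYamada2023, §6.1 (proof of Thm. B) and Prop. 2.14] -/
theorem isConj_standardCSMatrix_of_trace_eq_twentytwo (A : SL(3, ℤ))
    (hdet : ((A : Matrix (Fin 3) (Fin 3) ℤ) - 1).det = 1)
    (htr : Matrix.trace (A : Matrix (Fin 3) (Fin 3) ℤ) = 22) :
    IsConj A (standardCSMatrix 1 1 22 (one_dvd _)) ∨
      IsConj A (standardCSMatrix 8 3 22 rep0_dvd_eval_csPoly_twentytwo) ∨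
      IsConj A (standardCSMatrix 8 9 22 rep1_dvd_eval_csPoly_twentytwo) ∨
      IsConj A (standardCSMatrix 8 27 22 rep2_dvd_eval_csPoly_twentytwo) ∨
      IsConj A (standardCSMatrix 4 5 22 rep3_dvd_eval_csPoly_twentytwo) ∨
      IsConj A (standardCSMatrix 6 11 22 rep4_dvd_eval_csPoly_twentytwo) := by
  have hcover : ∀ J : Ideal (AdjoinRoot (csPoly 22)), J ≠ ⊥ →
      ∃ (c d : ℤ) (_ : d ∣ (csPoly 22).eval c) (x y : AdjoinRoot (csPoly 22)),
        x ≠ 0 ∧ y ≠ 0 ∧ Ideal.span {x} * J = Ideal.span {y} * csIdeal c d 22 ∧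
          ((c = 1 ∧ d = 1) ∨ (c = 8 ∧ d = 3) ∨ (c = 8 ∧ d = 9) ∨ (c = 8 ∧ d = 27) ∨ (c = 4 ∧ d = 5) ∨ (c = 6 ∧ d = 11)) := by
    intro J hJ
    obtain ⟨x, y, hx, hy, hxy⟩ := ideal_class_adjoinRoot_twentytwo J hJ
    rcases hxy with h0 | h1 | h2 | h3 | h4 | h5
    · exact ⟨1, 1, one_dvd _, x, y, hx, hy, h0, Or.inl ⟨rfl, rfl⟩⟩
    · exact ⟨8, 3, rep0_dvd_eval_csPoly_twentytwo, x, y, hx, hy, h1, Or.inr (Or.inl ⟨rfl, rfl⟩)⟩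
    · exact ⟨8, 9, rep1_dvd_eval_csPoly_twentytwo, x, y, hx, hy, h2, Or.inr (Or.inr (Or.inl ⟨rfl, rfl⟩))⟩
    · exact ⟨8, 27, rep2_dvd_eval_csPoly_twentytwo, x, y, hx, hy, h3, Or.inr (Or.inr (Or.inr (Or.inl ⟨rfl, rfl⟩)))⟩
    · exact ⟨4, 5, rep3_dvd_eval_csPoly_twentytwo, x, y, hx, hy, h4, Or.inr (Or.inr (Or.inr (Or.inr (Or.inl ⟨rfl, rfl⟩))))⟩
    · exact ⟨6, 11, rep4_dvd_eval_csPoly_twentytwo, x, y, hx, hy, h5, Or.inr (Or.inr (Or.inr (Or.inr (Or.inr (⟨rfl, rfl⟩)))))⟩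
  obtain ⟨c, d, h, hconj, hcd⟩ := exists_isConj_standardCSMatrix_of_cover _ hcover A hdet htr
  rcases hcd with ⟨rfl, rfl⟩ | ⟨rfl, rfl⟩ | ⟨rfl, rfl⟩ | ⟨rfl, rfl⟩ | ⟨rfl, rfl⟩ | ⟨rfl, rfl⟩
  · exact Or.inl hconj
  · exact Or.inr (Or.inl hconj)
  · exact Or.inr (Or.inr (Or.inl hconj))
  · exact Or.inr (Or.inr (Or.inr (Or.inl hconj)))
  · exact Or.inr (Or.inr (Or.inr (Or.inr (Or.inl hconj))))
  · exact Or.inr (Or.inr (Or.inr (Or.inr (Or.inr (hconj)))))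

/-- **Kim–Yamada 2023, Theorem B for the trace `22`, PROVED**: the five non-trivial classes move by
Gompf moves to the traces `10`, `4`, `-5`, `7`, `0`, where Gompf's conjecture holds. [cite: KimYamada2023, Thm. B and §6.1] -/
theorem gompfConjectureForTrace_twentytwo : GompfConjectureForTrace 22 := by
  intro A hdet htr
  rcases isConj_standardCSMatrix_of_trace_eq_twentytwo A hdet htr with h0 | h1 | h2 | h3 | h4 | h5
  · exact (GompfEquiv.of_isConj h0).trans (gompfEquiv_standardCSMatrix_one_one 20 (one_dvd _))
  · exact (GompfEquiv.of_isConj h1).trans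
      (gompfEquiv_standardCSMatrix_akbulutKirbyMatrix_of_modEq
        (gompfConjectureForTrace_ten_of aitchisonRubinstein1984_traceNegFiveClasses_holds) rep0_dvd_eval_csPoly_twentytwo
        (show (22 : ℤ) ≡ 10 [ZMOD 3] by decide))
  · exact (GompfEquiv.of_isConj h2).trans
      (gompfEquiv_standardCSMatrix_akbulutKirbyMatrix_of_modEq
        (gompfConjectureForTrace_of_mem_Icc (by norm_num)) rep1_dvd_eval_csPoly_twentytwo
        (show (22 : ℤ) ≡ 4 [ZMOD 9] by decide))
  · exact (GompfEquiv.of_isConj h3).trans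
      (gompfEquiv_standardCSMatrix_akbulutKirbyMatrix_of_modEq
        (gompfConjectureForTrace_neg_five_of aitchisonRubinstein1984_traceNegFiveClasses_holds) rep2_dvd_eval_csPoly_twentytwo
        (show (22 : ℤ) ≡ -5 [ZMOD 27] by decide))
  · exact (GompfEquiv.of_isConj h4).trans
      (gompfEquiv_standardCSMatrix_akbulutKirbyMatrix_of_modEq
        (gompfConjectureForTrace_of_mem_Icc (by norm_num)) rep3_dvd_eval_csPoly_twentytwo
        (show (22 : ℤ) ≡ 7 [ZMOD 5] by decide))
  · exact (GompfEquiv.of_isConj h5).trans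
      (gompfEquiv_standardCSMatrix_akbulutKirbyMatrix_of_modEq
        (gompfConjectureForTrace_of_mem_Icc (by norm_num)) rep4_dvd_eval_csPoly_twentytwo
        (show (22 : ℤ) ≡ 0 [ZMOD 11] by decide))

/-- **Theorem B for the trace `-17`** (`= 5 - 22`), by Theorem A. [cite: KimYamada2023, Thm. A and Thm. B] -/
theorem gompfConjectureForTrace_neg_seventeen : GompfConjectureForTrace (-17) := by
  have h := gompfConjectureForTrace_of_five_sub gompfConjectureForTrace_twentytwo
  norm_num at h
  exact h

end Matrices


end Literature.Topology.FourManifolds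

end
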